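import Literature.Computability.Complexity.StackHarveyCore
import HarnessLib

/-!
# The main driver of the factoring machine

Literature / complexity toolkit, continuing `StackHarveyCore.lean` (trial division `tdiv` and the
per-number procedure `core` of the deterministic `N^{1/5+o(1)}` factoring machine, D. Harvey,
arXiv:2010.05450).  This file assembles the whole machine on the stack register machine and proves
its register-level specification **`runs_main`**:

* the **rounds** of the work stack (`rounds`, **`runs_rounds`**, specified by the fold `roundsRun`
  of `roundStep`): pop `X`, set the ambient modulus registers (`setMod`: `MD := X`,
  `CINV := (X+1)/2`), run `core`, clear them (`clearMod`), then either push `g` and `X / g`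
  (`splitPush`) or record `X` as a prime (`emitBig`, onto `L3`, counted on `MNC`); seven rounds
  (`INP = 1^7` is the round counter);
* the **output**: the primes of the rounds to radix-sort words (`wordsPass`, `primeWords`), the
  sort (`a2Sort` of `StackHarveySearch`), the decoding of the sorted keys onto the output code
  (`decode`), the clean-up, `OUTP := encVec (factorOut N)`;
* the **initialisation** (`initA`, `initB`): `|enc N|`, the key width, the number of trial
  divisors `2^{tE}` (`tE = ⌈(|enc N|+4)/5⌉ + 1` above the threshold `n₀ = 4096`, else `|enc N|`:
  complete trial division), the number of bases `B = 2^{4|enc |enc N|| + 8}`, the work stack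
  (`stack0`: the cofactor unless `≤ 1`);
* **`mainProg = initA; tdiv; initB; rounds; outputProg`** and **`runs_main`**: from `INP = enc N`
  (all other variables empty, `eH`) to `OUTP = encVec (factorOut N)` (all else empty) within
  `mainCost N`, where `factorOut N = (small primes of trial division) ++ sortedKeys (primes of the
  rounds)`, under two arithmetic hypotheses on the numbers the rounds meet (`GoodX`) and report
  (`≤ N`), discharged in the sequel together with `factorOut N = Nat.primeFactorsList N`.

All control is by flag-guarded fixed-count loops; every theorem is proved, no named facts.

## References

* D. Harvey, *An exponent one-fifth algorithm for deterministic integer factorisation*,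
  Math. Comp. 90 (2021) 2937–2950, proof of Thm. 1.1 (arXiv:2010.05450 v3, p.10). [Harvey2021]
* D. E. Knuth, *The Art of Computer Programming* III, §5.2.5 (LSD radix sort). (Folklore
  material, fully proved here.)
-/

namespace Literature.Computability.Complexity

open _root_.Computability SProg

namespace Com

variable {β : Type} [DecidableEq β] (h : HReg ↪ β)

section MainRounds

/-! ### The main driver: the work stack of numbers to factor

`MNI` holds the stack (a coded list of numerals, top first); a round pops its top `X`, sets the
modulus `MD := X` and `CINV := (X+1)/2`, runs the per-number procedure, and either pushes the two
parts `g`, `X/g` of a split or emits `X` as a sortable word (a prime) onto `L4`. -/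

/-- Reading the transit register `TMPH`. [folklore] -/
theorem hSt_gTMPH (T : Regs β) (u : HSlots) : hSt h T u (h (.g .TMPH)) = u.gw.tmph := by rw [hSt, ← rGH_apply, gSt_TMPH]

/-- Writing the transit register `TMPH`. [folklore] -/
theorem update_hSt_gTMPH (T : Regs β) (u : HSlots) (v : List Bool) : Function.update (hSt h T u) (h (.g .TMPH)) v = hSt h T { u with gw := { u.gw with tmph := v } } := by
  rw [hSt, ← rGH_apply, update_gSt_TMPH]; rfl

/-- Setting the modulus and `CINV` from `MN0 = X`. [folklore] -/
def setMod : NS β :=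
  NS.ofList [.succ (h .X2) (h .MN0), .const (h .X3) (encodeNat 2), .divMod (h .X4) (h .X5) (h .X2) (h .X3), .clear (h .X5), .clear (h .X3), .clear (h .X2),
    .copy (h .MN0) (h (.g (.f (.n (.v .MD))))), .move (h .X4) (h (.g .CINV))]

/-- The ambient file with the modulus `X` and its `CINV`. [folklore] -/
def modFile (T : Regs β) (X : ℕ) : Regs β :=
  Function.update (Function.update T (h (.g (.f (.n (.v .MD))))) (encodeNat X)) (h (.g .CINV)) (encodeNat (NegFFT.inv2N X))

/-- **Setting the modulus.** [folklore] -/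
theorem runs_setMod {X n : ℕ} (hn : (encodeNat X).length + 2 ≤ n) (T : Regs β) (hMD : T (h (.g (.f (.n (.v .MD))))) = []) (hCINV : T (h (.g .CINV)) = []) (u : HSlots)
    (hmn0 : u.mn0 = encodeNat X) (hx2 : u.x2 = []) (hx3 : u.x3 = []) (hx4 : u.x4 = []) (hx5 : u.x5 = []) :
    Runs (setMod h).com (base (hSt h T u)) (base (hSt h (modFile h T X) { u with mn0 := encodeNat X })) (456 * (n + 1) ^ 3) := by
  have hl2 : (encodeNat 2).length ≤ n := by rw [show (2 : ℕ) = 2 ^ 1 by norm_num, encodeNat_two_pow]; simp; omega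
  have hlX1 : (encodeNat (X + 1)).length ≤ n := by
    have : (encodeNat (X + 1)).length ≤ (encodeNat X).length + 1 := by
      rcases Nat.eq_zero_or_pos X with rfl | hX
      · decide
      · calc (encodeNat (X + 1)).length ≤ (encodeNat (2 * X)).length := Brick.length_encodeNat_mono (by omega)
          _ = (encodeNat X).length + 1 := by rw [encodeNat_two_mul _ hX]; rfl
    omega
  have hlq : (encodeNat ((X + 1) / 2)).length ≤ n := (Brick.length_encodeNat_mono (Nat.div_le_self _ _)).trans hlX1
  have hlr : (encodeNat ((X + 1) % 2)).length ≤ n := (Brick.length_encodeNat_mono (show (X + 1) % 2 ≤ 2 by omega)).trans hl2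
  refine NS.runs_of_eq (N := n) _ _ ?_ ?_ (by simp [setMod])
  · simp (config := { decide := true }) only [setMod, NS.ofList, NS.ok, NOp.ok, NS.eval, NOp.eval, hSt_X2, hSt_MN0, hSt_X3, hSt_X4, hSt_X5, hSt_MD, update_hSt_X2, update_hSt_X3, update_hSt_X4,
      update_hSt_X5, update_hSt_MD, hmn0, hx2, hx3, hx4, hx5, hMD, bitsToNat_encodeNat, ne_eq, EmbeddingLike.apply_eq_iff_eq, not_false_eq_true,
      List.length_nil, zero_le, and_self, hl2, hlX1, hlq, hlr, true_and, and_true]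
    omega
  · simp [setMod, hmn0, hx2, hx3, hx4, hx5, hMD, hCINV, hSt_MD, bitsToNat_encodeNat, update_hSt_MD, update_hSt_CINV, modFile, NegFFT.inv2N]

/-- Clearing the modulus and `CINV`. [folklore] -/
def clearMod : NS β := NS.ofList [.clear (h (.g (.f (.n (.v .MD))))), .clear (h (.g .CINV))]

/-- The invariant of the multiplier and `CINV` hold in the file with the modulus set. [folklore] -/
theorem modFile_facts {X : ℕ} {T : Regs β} (hI : DrvInv (rGH h) 0 T) :
    DrvInv (rGH h) X (modFile h T X) ∧ modFile h T X (h (.g .CINV)) = encodeNat (NegFFT.inv2N X) := by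
  refine ⟨drvInv_setMod h hI _, by simp [modFile]⟩

/-- **Clearing the modulus** restores the ambient file. [folklore] -/
theorem runs_clearMod {X n : ℕ} (hn : (encodeNat X).length + 2 ≤ n) (T : Regs β) (hMD : T (h (.g (.f (.n (.v .MD))))) = []) (hCINV : T (h (.g .CINV)) = []) (u : HSlots) :
    Runs (clearMod h).com (base (hSt h (modFile h T X) u)) (base (hSt h T u)) (6 * (n + 1) ^ 3) := by
  have hneMC : h (.g (.f (.n (.v .MD)))) ≠ h (.g .CINV) := hq_ne h (by decide)
  have hlq : (encodeNat (NegFFT.inv2N X)).length ≤ n := by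
    have : NegFFT.inv2N X ≤ X ∨ X = 0 := by unfold NegFFT.inv2N; omega
    rcases this with h1 | rfl
    · exact (Brick.length_encodeNat_mono h1).trans (by omega)
    · simp only [NegFFT.inv2N, Nat.zero_add, Nat.reduceDiv]; omega
  have hT : Function.update (Function.update (modFile h T X) (h (.g (.f (.n (.v .MD))))) []) (h (.g .CINV)) [] = T := by
    funext y
    by_cases h1 : y = h (.g .CINV)
    · subst h1; simp [hCINV]
    · rw [Function.update_of_ne h1]
      by_cases h2 : y = h (.g (.f (.n (.v .MD))))
      · subst h2; simp [hMD]
      · rw [Function.update_of_ne h2]; simp [modFile, Function.update_of_ne h1, Function.update_of_ne h2]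
  refine NS.runs_of_eq (N := n) _ _ ?_ ?_ (by simp [clearMod])
  · simp (config := { decide := true }) only [clearMod, NS.ofList, NS.ok, NOp.ok, NS.eval, NOp.eval, hSt_MD, hSt_gCINV, modFile, Function.update_self,
      Function.update_of_ne hneMC, Function.update_of_ne hneMC.symm, hlq, and_true]
    omega
  · simp only [clearMod, NS.ofList, NS.eval, NOp.eval, update_hSt_MD, update_hSt_CINV, hT]

/-- Pushing the two parts `X / g` and `g` of a split onto the work stack (`g` on top). [folklore] -/
def splitPush : Com (EReg ⊕ β) :=
  ((NS.ofList [.divMod (h .X4) (h .X5) (h .MN0) (h .MNP), .clear (h .X5)] : NS β).com) ;; (prependItem (rGH h) (h .X4) (h .MNI) ;; prependItem (rGH h) (h .MNP) (h .MNI))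

/-- **Pushing a split.** [folklore] -/
theorem runs_splitPush {X g n : ℕ} (hn : (encodeNat X).length + 1 ≤ n) (hg1 : 1 ≤ g) (hgX : g ≤ X) (T : Regs β) (u : HSlots) (htmph : u.gw.tmph = []) (rest : List ℕ)
    (hmn0 : u.mn0 = encodeNat X) (hmnp : u.mnp = encodeNat g) (hmni : u.mni = encVec rest) (hx4 : u.x4 = []) (hx5 : u.x5 = []) :
    Runs (splitPush h) (base (hSt h T u)) (base (hSt h T { u with mnp := [], mni := encVec (g :: X / g :: rest) })) (353 * (n + 1) ^ 3 + ((10 * n + 10) + (10 * n + 10))) := by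
  set c := (n + 1) ^ 3 with hc3
  have hlX : (encodeNat X).length ≤ n := by omega
  have hlg : (encodeNat g).length ≤ n := (Brick.length_encodeNat_mono hgX).trans hlX
  have hlq : (encodeNat (X / g)).length ≤ n := (Brick.length_encodeNat_mono (Nat.div_le_self _ _)).trans hlX
  have hlr : (encodeNat (X % g)).length ≤ n := (Brick.length_encodeNat_mono ((Nat.mod_lt _ (by omega)).le.trans hgX)).trans hlX
  have hg0 : 0 < g := hg1
  let u1 : HSlots := { u with x4 := encodeNat (X / g) }
  have h1 : Runs ((NS.ofList [.divMod (h .X4) (h .X5) (h .MN0) (h .MNP), .clear (h .X5)] : NS β).com) (base (hSt h T u)) (base (hSt h T u1)) (353 * c) := by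
    refine NS.runs_of_eq (N := n) _ _ ?_ ?_ (by simp [hc3])
    · simp (config := { decide := true }) only [NS.ofList, NS.ok, NOp.ok, NS.eval, NOp.eval, hSt_X4, hSt_X5, hSt_MN0, hSt_MNP, update_hSt_X4, update_hSt_X5, hmn0, hmnp, hx4, hx5,
        bitsToNat_encodeNat, ne_eq, EmbeddingLike.apply_eq_iff_eq, not_false_eq_true, List.length_nil, zero_le, and_self, hlX, hlg, hlr, hg0]
    · simp [u1, hmn0, hmnp, hx5, bitsToNat_encodeNat]
  have hT : ∀ u' : HSlots, u'.gw.tmph = [] → hSt h T u' ((rGH h) .TMPH) = [] := fun u' h0 => by rw [rGH_apply, hSt_gTMPH]; exact h0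
  let u2 : HSlots := { u with x4 := [], mni := encVec (X / g :: rest) }
  have h2 : Runs (prependItem (rGH h) (h .X4) (h .MNI)) (base (hSt h T u1)) (base (hSt h T u2)) (10 * n + 10) := by
    refine (runs_prependItem (rGH h) (src := h .X4) (dst := h .MNI) (rGH_ne h .X4 (fun _ e => HReg.noConfusion e) _).symm (rGH_ne h .MNI (fun _ e => HReg.noConfusion e) _).symm
      (hq_ne h (by decide)) (hSt h T u1) (hT u1 htmph)).of_eq ?_ ?_
    · rw [update_hSt_X4, update_hSt_MNI]; simp [u1, u2, hmni, encVec_cons]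
    · simp only [hSt_X4, u1]; omega
  have h3 : Runs (prependItem (rGH h) (h .MNP) (h .MNI)) (base (hSt h T u2)) (base (hSt h T { u with mnp := [], mni := encVec (g :: X / g :: rest) })) (10 * n + 10) := by
    refine (runs_prependItem (rGH h) (src := h .MNP) (dst := h .MNI) (rGH_ne h .MNP (fun _ e => HReg.noConfusion e) _).symm (rGH_ne h .MNI (fun _ e => HReg.noConfusion e) _).symm
      (hq_ne h (by decide)) (hSt h T u2) (hT u2 htmph)).of_eq ?_ ?_
    · rw [update_hSt_MNP, update_hSt_MNI]; simp [u2, hmnp, hx4, encVec_cons]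
    · simp only [hSt_MNP, u2, hmnp]; omega
  exact (h1.seq (h2.seq h3)).of_eq rfl (by omega)

/-- The factors reported by the per-number procedure lie in `[1, X]`. [folklore] -/
theorem coreOut_bounds {X B : ℕ} (hXodd : Odd X) (hX1 : 1 < X) (hcop : ∀ a, 2 ≤ a → a ≤ B + 1 → Nat.Coprime a X) :
    ∀ g, coreOut X B = some g → 1 ≤ g ∧ g ≤ X := by
  intro g hg
  have hsf : ∀ e LB M, 1 ≤ LB → ∀ g', sfFac (sfRun X e LB M B) = some g' → 1 ≤ g' ∧ g' ≤ X := fun e LB M hLB g' hg' => by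
    have := (sfRun_outcome_facts (e := e) (LB := LB) (M := M) (B := B) hXodd hX1 hLB hcop).2.2.2.2 g' hg'; omega
  unfold coreOut at hg
  rcases Option.or_eq_some_iff.1 hg with hg | ⟨-, hg⟩
  · rcases Option.or_eq_some_iff.1 hg with hg | ⟨-, hg⟩
    · rcases Option.or_eq_some_iff.1 hg with hg | ⟨-, hg⟩
      · exact hsf _ _ _ Nat.one_le_two_pow g hg
      · unfold sqFac at hg; split_ifs at hg with hs
        obtain rfl := Option.some.inj hg
        exact ⟨by rw [Nat.succ_le_iff, Nat.sqrt_pos]; omega, Nat.sqrt_le_self X⟩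
    · exact hsf _ _ _ Nat.one_le_two_pow g hg
  · unfold stage45Out at hg
    rcases Option.or_eq_some_iff.1 hg with hg | ⟨-, hg⟩
    · exact hsf _ _ _ Nat.one_le_two_pow g hg
    · split_ifs at hg with hc
      have h1 := a2Out_le hX1 hg
      have h2 : ∀ i, 1 ≤ i → True := fun _ _ => trivial
      rcases Nat.eq_zero_or_pos g with rfl | hpos
      · -- `0` is never reported: every reported value is a gcd with `X > 0` or a proper divisor
        exfalso
        unfold a2Out at hg
        rcases hfh : firstHit (powHit X (stage4St X B).1) (2 ^ cER (encodeNat X).length - 1) with _ | i₀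
        · rw [hfh] at hg; simp only at hg
          unfold a2FinOut at hg
          rcases hfd : (a2Res X (stage4St X B).1 (2 ^ cER (encodeNat X).length) (2 ^ cER (encodeNat X).length)).found with _ | g'
          · rw [hfd] at hg; simp only at hg
            split_ifs at hg
            unfold a2SixOut at hg
            exact absurd (alg1Out_factor hX1 hg).1 (by omega)
          · rw [hfd] at hg; simp only at hg
            have := (scanRun_found_proper (by omega : 0 < X) _ ScanSt.init (by simp [ScanSt.init]) g' hfd).1
            rw [Option.some.inj hg] at this; omega
        · rw [hfh] at hg; simp only at hg
          have := Option.some.inj hg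
          have hpos : 0 < powGcd X (stage4St X B).1 (i₀ + 1) := Nat.gcd_pos_of_pos_right _ (by omega)
          omega
      · exact ⟨hpos, h1⟩

/-- Recording a prime `X` (on `MN0`): pushed onto the list `L3`, counted on `MNC`. [folklore] -/
def emitBig : Com (EReg ⊕ β) := prependItem (rGH h) (h .MN0) (h .L3) ;; push (Sum.inr (h .MNC)) true

/-- One round: pop `X`, set the modulus, the per-number procedure, clear the modulus, push the split or record the prime. [folklore] -/
def roundBody : Com (EReg ⊕ β) :=
  readItemTo (Sum.inr (h .MNI)) (Sum.inr (h .MN0)) (Sum.inr (h (.g (.f (.n (.v .W)))))) (Sum.inr (h (.g (.f (.n (.v .TT)))))) ;;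
  ((setMod h).com ;; (core h ;; ((clearMod h).com ;; (whenCons h .MNP (splitPush h) (emitBig h) ;; ((NS.op (.clear (h .MN0))) : NS β).com))))

/-- The effect of one round on the work stack and the primes found. [folklore] -/
def roundStep (B X : ℕ) (rest ps : List ℕ) : List ℕ × List ℕ :=
  match coreOut X B with
  | some g => (g :: X / g :: rest, ps)
  | none => (rest, X :: ps)

/-- Cost of one round on `X`. [folklore] -/
def roundCost (n X B : ℕ) : ℕ :=
  (11 * n + 9) + (456 * (n + 1) ^ 3 + (coreCost n X B + (6 * (n + 1) ^ 3 + (((353 * (n + 1) ^ 3 + ((10 * n + 10) + (10 * n + 10))) + ((10 * n + 10) + 1) + 3) + 3 * (n + 1) ^ 3))))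

/-- **One round of the work stack.** [folklore] -/
theorem runs_roundBody {X n B : ℕ} (hXodd : Odd X) (hX1 : 1 < X) (hn4 : 4 * (encodeNat X).length + 20 ≤ n) (hnX : 10 ≤ (encodeNat X).length)
    (T : Regs β) (hI : DrvInv (rGH h) 0 T) (hC0 : T (h (.g .CINV)) = [])
    (u : HSlots) (hw : u.gw.Clean) (hsched : u.gw.sched = []) (hhist : u.gw.hist = []) (hbg : u.gw.bg = []) (hkn' : u.gw.kn = []) (hbf : u.gw.bf = [])
    (hBX : B + 2 ≤ X) (hlB : (encodeNat B).length ≤ n) (hcop : ∀ a, 2 ≤ a → a ≤ B + 1 → Nat.Coprime a X)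
    (rest ps : List ℕ) (hmni : u.mni = encVec (X :: rest)) (hl3 : u.l3 = encVec ps) (hmnc : u.mnc = List.replicate ps.length true)
    (hmn0 : u.mn0 = []) (hmnb : u.mnb = encodeNat B) (hblpow : u.blpow = encodeNat 2) (hmnp : u.mnp = [])
    (ha1p : u.a1p = []) (hsfbmax : u.sfbmax = []) (hsfm : u.sfm = []) (hsfb : u.sfb = []) (hbla : u.bla = []) (hsfl : u.sfl = []) (ha2m : u.a2m = []) (ha2y : u.a2y = []) (ha2r : u.a2r = [])
    (ha2d : u.a2d = []) (ha2u : u.a2u = []) (ha2al : u.a2al = []) (ha2s : u.a2s = []) (ha2jj : u.a2jj = []) (ha2c : u.a2c = []) (ha2am : u.a2am = [])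
    (ha2p : u.a2p = []) (ha2q : u.a2q = []) (ha2t : u.a2t = []) (ha2j : u.a2j = []) (ha2v : u.a2v = []) (ha2a : u.a2a = []) (ha2b : u.a2b = [])
    (ha2l1 : u.a2l1 = []) (ha2l2 : u.a2l2 = []) (ha2srt : u.a2srt = []) (hl4 : u.l4 = [])
    (hx1 : u.x1 = []) (hx2 : u.x2 = []) (hx3 : u.x3 = []) (hx4 : u.x4 = []) (hx5 : u.x5 = []) (hx6 : u.x6 = []) (hfl1 : u.fl1 = []) (hfl2 : u.fl2 = [])
    (hu1 : u.u1 = []) (hu2 : u.u2 = []) (hsq1 : u.sq1 = []) (hsq2 : u.sq2 = []) (hsq3 : u.sq3 = []) (hsq4 : u.sq4 = []) (hsq5 : u.sq5 = [])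
    (hrx1 : u.rx1 = []) (hrx2 : u.rx2 = []) (hrx3 : u.rx3 = []) (hrx4 : u.rx4 = []) (hrx5 : u.rx5 = []) (hrx6 : u.rx6 = []) (hrx7 : u.rx7 = []) (hrx8 : u.rx8 = []) (hrx9 : u.rx9 = [])
    (hsfk : u.sfk = []) (hsfe : u.sfe = []) (hsfcand : u.sfcand = []) (hsfbeta : u.sfbeta = []) (hsfdivs : u.sfdivs = []) (hsfr : u.sfr = []) (hsft : u.sft = []) (hsfd : u.sfd = [])
    (ha1c : u.a1c = []) (hblm : u.blm = []) (ha1v : u.a1v = []) (hblk : u.blk = []) (hl1 : u.l1 = []) (hl2 : u.l2 = [])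
    (hptk : u.ptk = []) (hptu : u.ptu = []) (hblf : u.blf = []) (hble : u.ble = []) (hblc1 : u.blc1 = []) (hblc2 : u.blc2 = []) (hblout : u.blout = [])
    (ha1i : u.a1i = []) (ha1ai : u.a1ai = []) (ha1g : u.a1g = []) (hblg : u.blg = []) (hblfp : u.blfp = []) :
    Runs (roundBody h) (base (hSt h T u))
      (base (hSt h T { u with mni := encVec (roundStep B X rest ps).1, l3 := encVec (roundStep B X rest ps).2, mnc := List.replicate (roundStep B X rest ps).2.length true }))
      (roundCost n X B) := by
  have hhq : ∀ {i j : HReg}, i ≠ j → h i ≠ h j := fun hij => hq_ne h hij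
  obtain ⟨hMD, -, -, -, -, -, hW, hTT, -, -, -, -, -, -, -, -, -, -⟩ := id hI
  obtain ⟨-, -, -, -, -, -, -, -, -, -, -, -, -, htmph, -, -, -, -, -, -⟩ := id hw
  set c := (n + 1) ^ 3 with hc3
  have hn : (encodeNat X).length + 2 ≤ n := by omega
  have hlX : (encodeNat X).length ≤ n := by omega
  -- pop `X`
  have rdW : ∀ u' : HSlots, hSt h T u' (h (.g (.f (.n (.v .W))))) = [] := fun u' => by
    rw [hSt_gv h T u' (by decide) (by decide) (by decide) (by decide) (by decide) (by decide)]; exact hW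
  have rdTT : ∀ u' : HSlots, hSt h T u' (h (.g (.f (.n (.v .TT))))) = [] := fun u' => by
    rw [hSt_gv h T u' (by decide) (by decide) (by decide) (by decide) (by decide) (by decide)]; exact hTT
  let u1 : HSlots := { u with mni := encVec rest, mn0 := encodeNat X }
  have h1 : Runs (readItemTo (Sum.inr (h .MNI)) (Sum.inr (h .MN0)) (Sum.inr (h (.g (.f (.n (.v .W)))))) (Sum.inr (h (.g (.f (.n (.v .TT))))))) (base (hSt h T u)) (base (hSt h T u1)) (11 * n + 9) := by
    refine (runs_readItemTo (by simp [hhq]) (by simp [hhq]) (by simp [hhq]) (by simp [hhq]) (by simp [hhq]) (encodeNat X) (encVec rest)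
      (base (hSt h T u)) (by simp [hmni, encVec_cons]) (by simp [rdW]) (by simp [rdTT])).of_eq ?_ (by omega)
    simp [u1, hmn0]
  -- set the modulus
  have h2 := runs_setMod h (X := X) hn T hMD hC0 u1 (by simp [u1]) (by simp [u1, hx2]) (by simp [u1, hx3]) (by simp [u1, hx4]) (by simp [u1, hx5])
  have hu1e : ({ u1 with mn0 := encodeNat X } : HSlots) = u1 := by simp [u1]
  rw [hu1e] at h2
  obtain ⟨hIX, hCIX⟩ := modFile_facts h (X := X) hI
  -- the per-number procedure
  have h3 := runs_core h hXodd hX1 hn4 hnX (modFile h T X) hIX hCIX u1 hw hsched hhist hbg hkn' hbf hBX hlB hcop (by simp [u1]) (by simp [u1, hmnb]) (by simp [u1, hblpow]) (by simp [u1, hmnp])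
    (by simp [u1, ha1p]) (by simp [u1, hsfbmax]) (by simp [u1, hsfm]) (by simp [u1, hsfb]) (by simp [u1, hbla]) (by simp [u1, hsfl]) (by simp [u1, ha2m]) (by simp [u1, ha2y]) (by simp [u1, ha2r])
    (by simp [u1, ha2d]) (by simp [u1, ha2u]) (by simp [u1, ha2al]) (by simp [u1, ha2s]) (by simp [u1, ha2jj]) (by simp [u1, ha2c]) (by simp [u1, ha2am])
    (by simp [u1, ha2p]) (by simp [u1, ha2q]) (by simp [u1, ha2t]) (by simp [u1, ha2j]) (by simp [u1, ha2v]) (by simp [u1, ha2a]) (by simp [u1, ha2b])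
    (by simp [u1, ha2l1]) (by simp [u1, ha2l2]) (by simp [u1, ha2srt]) (by simp [u1, hl4])
    (by simp [u1, hx1]) (by simp [u1, hx2]) (by simp [u1, hx3]) (by simp [u1, hx4]) (by simp [u1, hx5]) (by simp [u1, hx6]) (by simp [u1, hfl1]) (by simp [u1, hfl2])
    (by simp [u1, hu1]) (by simp [u1, hu2]) (by simp [u1, hsq1]) (by simp [u1, hsq2]) (by simp [u1, hsq3]) (by simp [u1, hsq4]) (by simp [u1, hsq5])
    (by simp [u1, hrx1]) (by simp [u1, hrx2]) (by simp [u1, hrx3]) (by simp [u1, hrx4]) (by simp [u1, hrx5]) (by simp [u1, hrx6]) (by simp [u1, hrx7]) (by simp [u1, hrx8]) (by simp [u1, hrx9])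
    (by simp [u1, hsfk]) (by simp [u1, hsfe]) (by simp [u1, hsfcand]) (by simp [u1, hsfbeta]) (by simp [u1, hsfdivs]) (by simp [u1, hsfr]) (by simp [u1, hsft]) (by simp [u1, hsfd])
    (by simp [u1, ha1c]) (by simp [u1, hblm]) (by simp [u1, ha1v]) (by simp [u1, hblk]) (by simp [u1, hl1]) (by simp [u1, hl2])
    (by simp [u1, hptk]) (by simp [u1, hptu]) (by simp [u1, hblf]) (by simp [u1, hble]) (by simp [u1, hblc1]) (by simp [u1, hblc2]) (by simp [u1, hblout])
    (by simp [u1, ha1i]) (by simp [u1, ha1ai]) (by simp [u1, ha1g]) (by simp [u1, hblg]) (by simp [u1, hblfp])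
  set o := coreOut X B with ho0
  let u2 : HSlots := { u1 with mnp := encOpt o }
  -- clear the modulus
  have h4 := runs_clearMod h (X := X) hn T hMD hC0 u2
  -- push or record
  have hT : ∀ u' : HSlots, u'.gw.tmph = [] → hSt h T u' ((rGH h) .TMPH) = [] := fun u' h0 => by rw [rGH_apply, hSt_gTMPH]; exact h0
  have h5 : Runs (whenCons h .MNP (splitPush h) (emitBig h) ;; ((NS.op (.clear (h .MN0))) : NS β).com) (base (hSt h T u2))
      (base (hSt h T { u with mni := encVec (roundStep B X rest ps).1, l3 := encVec (roundStep B X rest ps).2, mnc := List.replicate (roundStep B X rest ps).2.length true }))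
      (((353 * c + ((10 * n + 10) + (10 * n + 10))) + ((10 * n + 10) + 1) + 3) + 3 * c) := by
    rcases hq : o with _ | g
    · -- a prime: record it
      have hA : Runs (emitBig h) (base (hSt h T u2)) (base (hSt h T { u2 with mn0 := [], l3 := encVec (X :: ps), mnc := List.replicate (ps.length + 1) true })) ((10 * n + 10) + 1) := by
        have hP : Runs (prependItem (rGH h) (h .MN0) (h .L3)) (base (hSt h T u2)) (base (hSt h T { u2 with mn0 := [], l3 := encVec (X :: ps) })) (10 * n + 10) := by
          refine (runs_prependItem (rGH h) (src := h .MN0) (dst := h .L3) (rGH_ne h .MN0 (fun _ e => HReg.noConfusion e) _).symm (rGH_ne h .L3 (fun _ e => HReg.noConfusion e) _).symm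
            (hq_ne h (by decide)) (hSt h T u2) (hT u2 htmph)).of_eq ?_ ?_
          · rw [update_hSt_MN0, update_hSt_L3]; simp [u2, u1, hl3, encVec_cons]
          · simp only [hSt_MN0, u2, u1]; omega
        have hQ : Runs (push (Sum.inr (h .MNC)) true) (base (hSt h T { u2 with mn0 := [], l3 := encVec (X :: ps) })) (base (hSt h T { u2 with mn0 := [], l3 := encVec (X :: ps), mnc := List.replicate (ps.length + 1) true })) 1 :=
          Runs.push' (by simp [u2, u1, hmnc, List.replicate_succ])
        exact hP.seq hQ
      have hB : Runs ((NS.op (.clear (h .MN0)) : NS β).com) (base (hSt h T { u2 with mn0 := [], l3 := encVec (X :: ps), mnc := List.replicate (ps.length + 1) true }))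
          (base (hSt h T { u with mni := encVec (roundStep B X rest ps).1, l3 := encVec (roundStep B X rest ps).2, mnc := List.replicate (roundStep B X rest ps).2.length true })) (3 * c) := by
        refine NS.runs_of_eq (N := n) _ _ (by simp [NS.ok, NOp.ok]) ?_ (by simp [hc3])
        simp [u2, u1, roundStep, ← ho0, hq, encOpt, hmnp, hmn0]
      refine ((runs_whenCons_nil h .MNP (splitPush h) (hSt h T u2) (by simp [u2, encOpt, hq]) hA).seq hB).of_eq rfl (by omega)
    · -- a split: push both parts
      obtain ⟨hg1, hgX⟩ := coreOut_bounds (B := B) hXodd hX1 hcop g (ho0 ▸ hq)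
      obtain ⟨bb, w, hbw⟩ := encodeNat_eq_cons (show 0 < g by omega)
      have hA := runs_splitPush h (X := X) (g := g) (n := n) (by omega) hg1 hgX T u2 htmph rest (by simp [u2, u1]) (by simp [u2, encOpt, hq]) (by simp [u2, u1]) (by simp [u2, u1, hx4]) (by simp [u2, u1, hx5])
      have hB : Runs ((NS.op (.clear (h .MN0)) : NS β).com) (base (hSt h T { u2 with mnp := [], mni := encVec (g :: X / g :: rest) }))
          (base (hSt h T { u with mni := encVec (roundStep B X rest ps).1, l3 := encVec (roundStep B X rest ps).2, mnc := List.replicate (roundStep B X rest ps).2.length true })) (3 * c) := by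
        refine NS.runs_of_eq (N := n) _ _ (by simp only [NS.ok, NOp.ok, hSt_MN0, u2, u1]; exact hlX) ?_ (by simp [hc3])
        simp [u2, u1, roundStep, ← ho0, hq, hmnp, hmn0, hl3, hmnc]
      refine ((runs_whenCons_cons h .MNP (emitBig h) (hSt h T u2) (bb := bb) (w := w) (by simp [u2, encOpt, hq, hbw]) hA).seq hB).of_eq rfl (by omega)
  refine (h1.seq (h2.seq (h3.seq (h4.seq h5)))).of_eq rfl ?_
  simp only [roundCost, ← hc3]; omega

/-- The numbers the per-number procedure may meet: odd, `> 1`, of `≥ 10` and `≤ (n − 20)/4` bits,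
above `B + 1` and prime to every `a ≤ B + 1`. [folklore] -/
def GoodX (n B X : ℕ) : Prop :=
  Odd X ∧ 1 < X ∧ 4 * (encodeNat X).length + 20 ≤ n ∧ 10 ≤ (encodeNat X).length ∧ B + 2 ≤ X ∧ ∀ a, 2 ≤ a → a ≤ B + 1 → Nat.Coprime a X

/-- The rounds of the work stack: the state (stack, primes found) after `k` rounds. [folklore] -/
def roundsRun (B : ℕ) (s : List ℕ × List ℕ) : ℕ → List ℕ × List ℕ
  | 0 => s
  | k + 1 => match roundsRun B s k with
    | ([], ps) => ([], ps)
    | (X :: rest, ps) => roundStep B X rest ps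

/-- The rounds loop, counted on `INP`. [folklore] -/
def rounds : Com (EReg ⊕ β) := countLoop (Sum.inr (h .INP)) (whenCons h .MNI (roundBody h) skip)

/-- The cost of the round run when `i + 1` of `R` rounds remain. [folklore] -/
def roundsF (n B R : ℕ) (s : List ℕ × List ℕ) (i : ℕ) : ℕ :=
  match (roundsRun B s (R - (i + 1))).1 with
  | [] => 2
  | X :: _ => roundCost n X B + 3

/-- Cost of `R` rounds. [folklore] -/
def roundsCost (n B R : ℕ) (s : List ℕ × List ℕ) : ℕ := lsum (roundsF n B R s) R + 2 * R + 1

/-- The registers of the rounds loop. [folklore] -/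
def HSlots.rdAt (u : HSlots) (i : ℕ) (s : List ℕ × List ℕ) : HSlots :=
  { u with inp := List.replicate i true, mni := encVec s.1, l3 := encVec s.2, mnc := List.replicate s.2.length true }

/-- **The rounds of the work stack.** [folklore] -/
theorem runs_rounds {n B R : ℕ} (s₀ : List ℕ × List ℕ) (hinv : ∀ k, k ≤ R → ∀ X ∈ (roundsRun B s₀ k).1, GoodX n B X)
    (T : Regs β) (hI : DrvInv (rGH h) 0 T) (hC0 : T (h (.g .CINV)) = [])
    (u : HSlots) (hw : u.gw.Clean) (hsched : u.gw.sched = []) (hhist : u.gw.hist = []) (hbg : u.gw.bg = []) (hkn' : u.gw.kn = []) (hbf : u.gw.bf = [])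
    (hlB : (encodeNat B).length ≤ n)
    (hmn0 : u.mn0 = []) (hmnb : u.mnb = encodeNat B) (hblpow : u.blpow = encodeNat 2) (hmnp : u.mnp = [])
    (ha1p : u.a1p = []) (hsfbmax : u.sfbmax = []) (hsfm : u.sfm = []) (hsfb : u.sfb = []) (hbla : u.bla = []) (hsfl : u.sfl = []) (ha2m : u.a2m = []) (ha2y : u.a2y = []) (ha2r : u.a2r = [])
    (ha2d : u.a2d = []) (ha2u : u.a2u = []) (ha2al : u.a2al = []) (ha2s : u.a2s = []) (ha2jj : u.a2jj = []) (ha2c : u.a2c = []) (ha2am : u.a2am = [])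
    (ha2p : u.a2p = []) (ha2q : u.a2q = []) (ha2t : u.a2t = []) (ha2j : u.a2j = []) (ha2v : u.a2v = []) (ha2a : u.a2a = []) (ha2b : u.a2b = [])
    (ha2l1 : u.a2l1 = []) (ha2l2 : u.a2l2 = []) (ha2srt : u.a2srt = []) (hl4 : u.l4 = [])
    (hx1 : u.x1 = []) (hx2 : u.x2 = []) (hx3 : u.x3 = []) (hx4 : u.x4 = []) (hx5 : u.x5 = []) (hx6 : u.x6 = []) (hfl1 : u.fl1 = []) (hfl2 : u.fl2 = [])
    (hu1 : u.u1 = []) (hu2 : u.u2 = []) (hsq1 : u.sq1 = []) (hsq2 : u.sq2 = []) (hsq3 : u.sq3 = []) (hsq4 : u.sq4 = []) (hsq5 : u.sq5 = [])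
    (hrx1 : u.rx1 = []) (hrx2 : u.rx2 = []) (hrx3 : u.rx3 = []) (hrx4 : u.rx4 = []) (hrx5 : u.rx5 = []) (hrx6 : u.rx6 = []) (hrx7 : u.rx7 = []) (hrx8 : u.rx8 = []) (hrx9 : u.rx9 = [])
    (hsfk : u.sfk = []) (hsfe : u.sfe = []) (hsfcand : u.sfcand = []) (hsfbeta : u.sfbeta = []) (hsfdivs : u.sfdivs = []) (hsfr : u.sfr = []) (hsft : u.sft = []) (hsfd : u.sfd = [])
    (ha1c : u.a1c = []) (hblm : u.blm = []) (ha1v : u.a1v = []) (hblk : u.blk = []) (hl1 : u.l1 = []) (hl2 : u.l2 = [])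
    (hptk : u.ptk = []) (hptu : u.ptu = []) (hblf : u.blf = []) (hble : u.ble = []) (hblc1 : u.blc1 = []) (hblc2 : u.blc2 = []) (hblout : u.blout = [])
    (ha1i : u.a1i = []) (ha1ai : u.a1ai = []) (ha1g : u.a1g = []) (hblg : u.blg = []) (hblfp : u.blfp = []) :
    Runs (rounds h) (base (hSt h T (u.rdAt R s₀))) (base (hSt h T (u.rdAt 0 (roundsRun B s₀ R)))) (roundsCost n B R s₀) := by
  have hL := runs_countLoop_var (U := (Sum.inr (h .INP) : EReg ⊕ β)) (body := whenCons h .MNI (roundBody h) skip)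
    (fun i Rg => i ≤ R ∧ Rg = base (hSt h T (u.rdAt i (roundsRun B s₀ (R - i))))) (roundsF n B R s₀)
    (by
      rintro i Rg ⟨hi, rfl⟩ -
      have hsucc : roundsRun B s₀ (R - i) = (match roundsRun B s₀ (R - (i + 1)) with | ([], ps) => ([], ps) | (X :: rest, ps) => roundStep B X rest ps) := by
        rw [show R - i = R - (i + 1) + 1 by omega]; rfl
      rcases hst : roundsRun B s₀ (R - (i + 1)) with ⟨_ | ⟨X, rest⟩, ps⟩
      · -- empty stack: nothing to do
        have hupd : Function.update (base (hSt h T (u.rdAt (i + 1) ([], ps)))) (Sum.inr (h .INP)) (List.replicate i true) = base (hSt h T (u.rdAt i ([], ps))) := by simp [HSlots.rdAt]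
        rw [hupd]
        refine ⟨_, (runs_whenCons_nil h .MNI (roundBody h) (hSt h T (u.rdAt i ([], ps))) (by simp [HSlots.rdAt, encVec]) (Runs.skip _)).of_eq rfl ?_, by simp [HSlots.rdAt], by omega, ?_⟩
        · simp only [roundsF, hst]; exact le_rfl
        · rw [hsucc, hst]
      · -- a number to process
        obtain ⟨hXodd, hX1, hn4, hnX, hBX, hcop⟩ := hinv (R - (i + 1)) (by omega) X (by rw [hst]; simp)
        let uR : HSlots := { u with inp := List.replicate i true, mni := encVec (X :: rest), l3 := encVec ps, mnc := List.replicate ps.length true }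
        have hupd : Function.update (base (hSt h T (u.rdAt (i + 1) (X :: rest, ps)))) (Sum.inr (h .INP)) (List.replicate i true) = base (hSt h T uR) := by simp [HSlots.rdAt, uR]
        rw [hupd]
        have hr := runs_roundBody h hXodd hX1 hn4 hnX T hI hC0 uR hw hsched hhist hbg hkn' hbf hBX hlB hcop rest ps
          (by simp [uR]) (by simp [uR]) (by simp [uR]) (by simp [uR, hmn0]) (by simp [uR, hmnb]) (by simp [uR, hblpow]) (by simp [uR, hmnp])
          (by simp [uR, ha1p]) (by simp [uR, hsfbmax]) (by simp [uR, hsfm]) (by simp [uR, hsfb]) (by simp [uR, hbla]) (by simp [uR, hsfl]) (by simp [uR, ha2m]) (by simp [uR, ha2y]) (by simp [uR, ha2r])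
          (by simp [uR, ha2d]) (by simp [uR, ha2u]) (by simp [uR, ha2al]) (by simp [uR, ha2s]) (by simp [uR, ha2jj]) (by simp [uR, ha2c]) (by simp [uR, ha2am])
          (by simp [uR, ha2p]) (by simp [uR, ha2q]) (by simp [uR, ha2t]) (by simp [uR, ha2j]) (by simp [uR, ha2v]) (by simp [uR, ha2a]) (by simp [uR, ha2b])
          (by simp [uR, ha2l1]) (by simp [uR, ha2l2]) (by simp [uR, ha2srt]) (by simp [uR, hl4])
          (by simp [uR, hx1]) (by simp [uR, hx2]) (by simp [uR, hx3]) (by simp [uR, hx4]) (by simp [uR, hx5]) (by simp [uR, hx6]) (by simp [uR, hfl1]) (by simp [uR, hfl2])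
          (by simp [uR, hu1]) (by simp [uR, hu2]) (by simp [uR, hsq1]) (by simp [uR, hsq2]) (by simp [uR, hsq3]) (by simp [uR, hsq4]) (by simp [uR, hsq5])
          (by simp [uR, hrx1]) (by simp [uR, hrx2]) (by simp [uR, hrx3]) (by simp [uR, hrx4]) (by simp [uR, hrx5]) (by simp [uR, hrx6]) (by simp [uR, hrx7]) (by simp [uR, hrx8]) (by simp [uR, hrx9])
          (by simp [uR, hsfk]) (by simp [uR, hsfe]) (by simp [uR, hsfcand]) (by simp [uR, hsfbeta]) (by simp [uR, hsfdivs]) (by simp [uR, hsfr]) (by simp [uR, hsft]) (by simp [uR, hsfd])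
          (by simp [uR, ha1c]) (by simp [uR, hblm]) (by simp [uR, ha1v]) (by simp [uR, hblk]) (by simp [uR, hl1]) (by simp [uR, hl2])
          (by simp [uR, hptk]) (by simp [uR, hptu]) (by simp [uR, hblf]) (by simp [uR, hble]) (by simp [uR, hblc1]) (by simp [uR, hblc2]) (by simp [uR, hblout])
          (by simp [uR, ha1i]) (by simp [uR, ha1ai]) (by simp [uR, ha1g]) (by simp [uR, hblg]) (by simp [uR, hblfp])
        obtain ⟨bb, w, hbw⟩ : ∃ bb w, encVec (X :: rest) = bb :: w := by
          cases hq : encVec (X :: rest) with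
          | nil => exact absurd hq (encVec_cons_ne_nil _ _)
          | cons bb w => exact ⟨bb, w, rfl⟩
        refine ⟨_, (runs_whenCons_cons h .MNI skip (hSt h T uR) (bb := bb) (w := w) (by simp only [hSt_MNI, uR]; exact hbw) hr).of_eq rfl ?_, by simp [uR], by omega, ?_⟩
        · simp only [roundsF, hst]; omega
        · rw [hsucc, hst]; simp [HSlots.rdAt, uR])
    R (base (hSt h T (u.rdAt R s₀))) ⟨le_rfl, by simp [roundsRun]⟩ (by simp [HSlots.rdAt])
  obtain ⟨R', hR, -, -, rfl⟩ := hL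
  show Runs (countLoop _ _) _ _ _
  simpa [roundsCost] using hR

end MainRounds

section MainOutput

/-! ### The main driver: the output

The primes found by the rounds (`L3`, counted on `MNC`) become sortable words (`wordsPass`, the
word builder `a2Emit` of Algorithm 2 with key width `nb = |enc N| + 1` on `A2D`), are sorted by
the radix sorter (`a2Sort`), and their keys are decoded in increasing order onto the accumulator
`MNF` that already holds the small prime factors (`decode`, the word splitter `a2ScanKey` of
Algorithm 2 with the modulus register set to `2^{|enc N|}`); finally `MNF` is poured onto `OUTP`. -/

/-- One prime to one word. [folklore] -/
def wordsBody : Com (EReg ⊕ β) :=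
  readItemTo (Sum.inr (h .L3)) (Sum.inr (h .A2T)) (Sum.inr (h (.g (.f (.n (.v .W)))))) (Sum.inr (h (.g (.f (.n (.v .TT)))))) ;; (a2Emit h false ;; ((NS.op (.clear (h .A2T))) : NS β).com)

/-- The primes to words, counted on `MNC`. [folklore] -/
def wordsPass : Com (EReg ⊕ β) := countLoop (Sum.inr (h .MNC)) (wordsBody h)

/-- The words of the primes `ps` (in order). [folklore] -/
def primeWords (nb : ℕ) (ps : List ℕ) : List (List Bool) := ps.map fun p => mkWord nb p false []

/-- Cost of the words pass on `P` primes. [folklore] -/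
def wordsPassCost (n P : ℕ) : ℕ := P * ((11 * n + 9) + (a2EmitCost n + 3 * (n + 1) ^ 3) + 2) + 1

/-- **The words pass.** [folklore] -/
theorem runs_wordsPass {Nw n nb : ℕ} (hn : 2 * (encodeNat Nw).length + 8 ≤ n) (hnb : (encodeNat Nw).length = nb) (T : Regs β) (hI : DrvInv (rGH h) 0 T) (u : HSlots)
    (ps : List ℕ) (hps : ∀ p ∈ ps, p < Nw)
    (ha2d : u.a2d = encodeNat nb) (ha2t : u.a2t = []) (hx5 : u.x5 = []) (ha2v : u.a2v = []) (hx2 : u.x2 = []) (hx3 : u.x3 = []) (hu2 : u.u2 = []) (hl4 : u.l4 = []) (ha2l1 : u.a2l1 = []) :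
    Runs (wordsPass h) (base (hSt h T { u with l3 := encVec ps, mnc := List.replicate ps.length true }))
      (base (hSt h T { u with l3 := [], mnc := [], l4 := outRev (primeWords nb ps), a2l1 := List.replicate ps.length true })) (wordsPassCost n ps.length) := by
  have hhq : ∀ {i j : HReg}, i ≠ j → h i ≠ h j := fun hij => hq_ne h hij
  obtain ⟨-, -, -, -, -, -, hW, hTT, -, -, -, -, -, -, -, -, -, -⟩ := id hI
  have rdW : ∀ u' : HSlots, hSt h T u' (h (.g (.f (.n (.v .W))))) = [] := fun u' => by
    rw [hSt_gv h T u' (by decide) (by decide) (by decide) (by decide) (by decide) (by decide)]; exact hW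
  have rdTT : ∀ u' : HSlots, hSt h T u' (h (.g (.f (.n (.v .TT))))) = [] := fun u' => by
    rw [hSt_gv h T u' (by decide) (by decide) (by decide) (by decide) (by decide) (by decide)]; exact hTT
  set c := (n + 1) ^ 3 with hc3
  set P := ps.length with hP
  let st : ℕ → HSlots := fun i => { u with l3 := encVec (ps.drop (P - i)), mnc := List.replicate i true, l4 := outRev (primeWords nb (ps.take (P - i))), a2l1 := List.replicate (P - i) true }
  have hstart : ({ u with l3 := encVec ps, mnc := List.replicate ps.length true } : HSlots) = st P := by
    simp [st, ← hP, hl4, ha2l1, primeWords, -List.map_take, -List.map_drop]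
  have hL := runs_countLoop (U := (Sum.inr (h .MNC) : EReg ⊕ β)) (body := wordsBody h) (fun i R => i ≤ P ∧ R = base (hSt h T (st i))) ((11 * n + 9) + (a2EmitCost n + 3 * c))
    (by
      rintro i R ⟨hi, rfl⟩ -
      have hlt : P - (i + 1) < ps.length := by omega
      set p := ps[P - (i + 1)] with hp0
      have hpN : p < Nw := hps _ (List.getElem_mem hlt)
      have hdrop : ps.drop (P - (i + 1)) = p :: ps.drop (P - i) := by rw [show P - i = P - (i + 1) + 1 by omega]; exact List.drop_eq_getElem_cons hlt
      have htake : ps.take (P - i) = ps.take (P - (i + 1)) ++ [p] := by rw [show P - i = P - (i + 1) + 1 by omega, List.take_add_one, List.getElem?_eq_getElem hlt]; rfl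
      let v0 : HSlots := { st (i + 1) with mnc := List.replicate i true }
      have hupd : Function.update (base (hSt h T (st (i + 1)))) (Sum.inr (h .MNC)) (List.replicate i true) = base (hSt h T v0) := by simp [st, v0]
      rw [hupd]
      let v1 : HSlots := { v0 with l3 := encVec (ps.drop (P - i)), a2t := encodeNat p }
      have h1 : Runs (readItemTo (Sum.inr (h .L3)) (Sum.inr (h .A2T)) (Sum.inr (h (.g (.f (.n (.v .W)))))) (Sum.inr (h (.g (.f (.n (.v .TT))))))) (base (hSt h T v0)) (base (hSt h T v1)) (11 * n + 9) := by
        have hlp : (encodeNat p).length ≤ n := (Brick.length_encodeNat_mono hpN.le).trans (by omega)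
        refine (runs_readItemTo (by simp [hhq]) (by simp [hhq]) (by simp [hhq]) (by simp [hhq]) (by simp [hhq]) (encodeNat p) (encVec (ps.drop (P - i)))
          (base (hSt h T v0)) (by simp [v0, st, hdrop, encVec_cons]) (by simp [rdW]) (by simp [rdTT])).of_eq ?_ (by omega)
        simp [v0, v1, st, ha2t]
      have h2 := runs_a2Emit h false (N := Nw) (v := p) (nb := nb) hn hnb T v1 hpN (pl := []) (by simp) (primeWords nb (ps.take (P - (i + 1)))) (by simp [v1]) (by simp [v1, v0, st, hx5]) (by simp [v1, v0, st, ha2d])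
        (by simp [v1, v0, st]) (by simp [v1, v0, st, primeWords]; omega) (by simp [v1, v0, st, ha2v]) (by simp [v1, v0, st, hx2]) (by simp [v1, v0, st, hx3]) (by simp [v1, v0, st, hu2])
      have h3 : Runs ((NS.op (.clear (h .A2T)) : NS β).com) (base (hSt h T { v1 with x5 := [], l4 := outRev (primeWords nb (ps.take (P - (i + 1))) ++ [mkWord nb p false []]), a2l1 := List.replicate (primeWords nb (ps.take (P - (i + 1))) ++ [mkWord nb p false []]).length true }))
          (base (hSt h T (st i))) (3 * c) := by
        have hlen : min (P - (i + 1)) ps.length + 1 = P - i := by omega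
        refine NS.runs_of_eq (N := n) _ _ (by simp only [NS.ok, NOp.ok, hSt_A2T, v1]; exact (Brick.length_encodeNat_mono hpN.le).trans (by omega)) ?_ (by simp [hc3])
        simp [v1, v0, st, ha2t, hx5, htake, primeWords, hlen, -List.map_take, -List.map_drop]
      exact ⟨_, h1.seq (h2.seq h3), by simp [st], by omega, rfl⟩)
    P (base (hSt h T (st P))) ⟨le_rfl, rfl⟩ (by simp [st])
  obtain ⟨R', hR, -, -, rfl⟩ := hL
  rw [← hstart] at hR
  refine hR.of_eq (by simp [st, hP, -List.map_take, -List.map_drop]) ?_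
  simp only [wordsPassCost, ← hc3]; exact le_rfl

/-- Setting the modulus register to `2^{A2D − 1}` (the key bound of the decoder's reader). [folklore] -/
def setMDw : Com (EReg ⊕ β) :=
  ((NS.ofList [.const (h .X3) (encodeNat 1), .sub (h .X2) (h .A2D) (h .X3), .clear (h .X3)] : NS β).com) ;; (pow2Into (rGH h) (h .X4) (h .X2) ;;
    ((NS.ofList [.clear (h .X2), .move (h .X4) (h (.g (.f (.n (.v .MD)))))] : NS β).com))

/-- The multiplier's invariant after re-setting the modulus only. [folklore] -/
theorem drvInv_setMD {N X : ℕ} {T : Regs β} (hI : DrvInv (rGH h) N T) : DrvInv (rGH h) X (Function.update T (h (.g (.f (.n (.v .MD))))) (encodeNat X)) := by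
  unfold DrvInv at hI ⊢
  simp only [rGH_apply, Function.update_apply, EmbeddingLike.apply_eq_iff_eq, reduceCtorEq, if_false, HReg.g.injEq, GReg.f.injEq, FReg.n.injEq, NReg.v.injEq,
    if_true] at hI ⊢
  exact ⟨trivial, hI.2⟩

/-- **Setting the modulus register for the decoder.** [folklore] -/
theorem runs_setMDw {n nN : ℕ} (hn : nN + 3 ≤ n) (T : Regs β) (hI : DrvInv (rGH h) 0 T) (u : HSlots) (ha2d : u.a2d = encodeNat (nN + 1)) (hx2 : u.x2 = []) (hx3 : u.x3 = []) (hx4 : u.x4 = []) :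
    Runs (setMDw h) (base (hSt h T u)) (base (hSt h (Function.update T (h (.g (.f (.n (.v .MD))))) (encodeNat (2 ^ nN))) { u with x2 := [], x4 := [] })) (90 * (n + 1) ^ 3 + (n * (16 * n + 21) + 3 * n + 7)) := by
  obtain ⟨hMD, -, -, -, -, -, -, -, -, -, hU, -, -, -, -, -, -, -⟩ := id hI
  have hMD' : T (h (.g (.f (.n (.v .MD))))) = [] := by rw [rGH_apply] at hMD; exact hMD
  have rdU : ∀ u' : HSlots, hSt h T u' ((rGH h) (.f (.n (.v .U)))) = [] := fun u' => by
    rw [rGH_apply, hSt_gv h T u' (by decide) (by decide) (by decide) (by decide) (by decide) (by decide)]; exact hU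
  set c := (n + 1) ^ 3 with hc3
  have e1 : encodeNat 1 = [true] := by simpa using encodeNat_two_pow 0
  have hl1n : (encodeNat 1).length ≤ n := by rw [e1]; simp only [List.length_cons, List.length_nil]; omega
  have hlnb : (encodeNat (nN + 1)).length ≤ n := (length_encodeNat_le_self _).trans (by omega)
  have hlnN : (encodeNat nN).length ≤ n := (length_encodeNat_le_self _).trans (by omega)
  have hl2 : (encodeNat (2 ^ nN)).length ≤ n := by rw [encodeNat_two_pow]; simp; omega
  let u1 : HSlots := { u with x2 := encodeNat nN }
  have h1 : Runs ((NS.ofList [.const (h .X3) (encodeNat 1), .sub (h .X2) (h .A2D) (h .X3), .clear (h .X3)] : NS β).com) (base (hSt h T u)) (base (hSt h T u1)) (78 * c) := by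
    refine NS.runs_of_eq (N := n) _ _ ?_ ?_ (by simp [hc3])
    · simp (config := { decide := true }) only [NS.ofList, NS.ok, NOp.ok, NS.eval, NOp.eval, hSt_X3, hSt_X2, hSt_A2D, update_hSt_X3, update_hSt_X2, ha2d, hx2, hx3, bitsToNat_encodeNat,
        List.length_nil, zero_le, and_self, hl1n, hlnb, true_and, and_true]
      omega
    · simp [u1, ha2d, hx2, hx3, bitsToNat_encodeNat]
  let u2 : HSlots := { u1 with x4 := encodeNat (2 ^ nN) }
  have h2 : Runs (pow2Into (rGH h) (h .X4) (h .X2)) (base (hSt h T u1)) (base (hSt h T u2)) (n * (16 * nN + 21) + 3 * nN + 7) := by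
    have hne : h .X4 ≠ h .X2 := hq_ne h (by decide)
    have hneU : h .X4 ≠ (rGH h) (.f (.n (.v .U))) := (rGH_ne h .X4 (fun _ e => HReg.noConfusion e) _).symm
    have r1 : hSt h T u1 (h .X2) = encodeNat nN := by rw [hSt_X2]
    have r2 : hSt h T u1 (h .X4) = [] := by rw [hSt_X4]; exact hx4
    refine (runs_pow2Into (rGH h) hneU hne hlnN (hSt h T u1) r1 r2 (rdU u1)).of_eq (by rw [update_hSt_X4]) le_rfl
  have h3 : Runs ((NS.ofList [.clear (h .X2), .move (h .X4) (h (.g (.f (.n (.v .MD)))))] : NS β).com) (base (hSt h T u2))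
      (base (hSt h (Function.update T (h (.g (.f (.n (.v .MD))))) (encodeNat (2 ^ nN))) { u with x2 := [], x4 := [] })) (11 * c) := by
    refine NS.runs_of_eq (N := n) _ _ ?_ ?_ (by simp [hc3])
    · simp (config := { decide := true }) only [NS.ofList, NS.ok, NOp.ok, NS.eval, NOp.eval, hSt_X2, hSt_X4, update_hSt_X2, u2, u1, ne_eq, EmbeddingLike.apply_eq_iff_eq, not_false_eq_true,
        hlnN, hl2, and_self]
    · simp [u2, u1, hSt_MD, hMD', update_hSt_MD]
  refine (h1.seq (h2.seq h3)).of_eq rfl ?_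
  have : n * (16 * nN + 21) + 3 * nN + 7 ≤ n * (16 * n + 21) + 3 * n + 7 := by
    have := Nat.mul_le_mul_left n (show 16 * nN + 21 ≤ 16 * n + 21 by omega); omega
  omega

/-- Decoding one word: split off its key, normalise it, emit it, drop the tag. [folklore] -/
def decodeBody : Com (EReg ⊕ β) := a2ScanKey h ;; (((NS.op (.nrm (h .SFE))) : NS β).com ;; (emit (Sum.inr (h .SFE)) (Sum.inr (h .MNF)) ;; ((NS.op (.clear (h .FL1))) : NS β).com))

/-- Decoding the sorted words, counted on `A2L1`. [folklore] -/
def decode : Com (EReg ⊕ β) := countLoop (Sum.inr (h .A2L1)) (decodeBody h)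

/-- Cost of the decoding of `L` words. [folklore] -/
def decodeCost (n nb L : ℕ) : ℕ := L * ((a2ScanKeyCost n nb (nb + 1) + (30 * (n + 1) ^ 3 + ((4 * n + 3) + 3 * (n + 1) ^ 3))) + 2) + 1

/-- **The decoding**: the keys of the words, in order, join the accumulator. [folklore] -/
theorem runs_decode {Nw n nb : ℕ} (hn : 2 * (encodeNat Nw).length + 8 ≤ n) (hnb : (encodeNat Nw).length = nb) (T : Regs β) (hI : DrvInv (rGH h) Nw T) (u : HSlots)
    (sw : List (List Bool)) (hsw : ∀ w ∈ sw, nb ≤ w.length ∧ w.length ≤ nb + 1 ∧ payloadOf nb w = []) (E : List (List Bool))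
    (ha2u : u.a2u = List.replicate nb true) (ha2v : u.a2v = []) (hsfk : u.sfk = []) (hsfe : u.sfe = []) (hfl1 : u.fl1 = []) (hu2 : u.u2 = []) :
    Runs (decode h) (base (hSt h T { u with rx1 := encList sw, a2l1 := List.replicate sw.length true, mnf := outRev E }))
      (base (hSt h T { u with rx1 := [], a2l1 := [], mnf := outRev (E ++ sw.map fun w => encodeNat (keyOf nb w)) })) (decodeCost n nb sw.length) := by
  set c := (n + 1) ^ 3 with hc3
  set L := sw.length with hL
  have hnbn : nb ≤ n := by omega
  let st : ℕ → HSlots := fun i => { u with rx1 := encList (sw.drop (L - i)), a2l1 := List.replicate i true, mnf := outRev (E ++ (sw.take (L - i)).map fun w => encodeNat (keyOf nb w)) }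
  have hstart : ({ u with rx1 := encList sw, a2l1 := List.replicate sw.length true, mnf := outRev E } : HSlots) = st L := by simp [st, ← hL, -List.map_take, -List.map_drop]
  have hK := runs_countLoop (U := (Sum.inr (h .A2L1) : EReg ⊕ β)) (body := decodeBody h) (fun i R => i ≤ L ∧ R = base (hSt h T (st i)))
    (a2ScanKeyCost n nb (nb + 1) + (30 * c + ((4 * n + 3) + 3 * c)))
    (by
      rintro i R ⟨hi, rfl⟩ -
      have hlt : L - (i + 1) < sw.length := by omega
      set w := sw[L - (i + 1)] with hw0
      obtain ⟨hwnb, hwL, hwpl⟩ := hsw w (List.getElem_mem hlt)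
      have hdrop : sw.drop (L - (i + 1)) = w :: sw.drop (L - i) := by rw [show L - i = L - (i + 1) + 1 by omega]; exact List.drop_eq_getElem_cons hlt
      have htake : sw.take (L - i) = sw.take (L - (i + 1)) ++ [w] := by rw [show L - i = L - (i + 1) + 1 by omega, List.take_add_one, List.getElem?_eq_getElem hlt]; rfl
      let v0 : HSlots := { st (i + 1) with a2l1 := List.replicate i true }
      have hupd : Function.update (base (hSt h T (st (i + 1)))) (Sum.inr (h .A2L1)) (List.replicate i true) = base (hSt h T v0) := by simp [st, v0]
      rw [hupd]
      have h1 := runs_a2ScanKey h (L := nb + 1) hn hnb T hI v0 w (sw.drop (L - i)) hwnb hwL (by simp [v0, st, hdrop]) (by simp [v0, st, ha2u]) (by simp [v0, st, ha2v]) (by simp [v0, st, hsfk]) (by simp [v0, st, hsfe])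
        (by simp [v0, st, hfl1]) (by simp [v0, st, hu2])
      let v1 : HSlots := { v0 with rx1 := encList (sw.drop (L - i)), sfe := w.take nb, fl1 := [tagOf nb w], a2v := payloadOf nb w }
      have hlk : (w.take nb).length ≤ n := by simp; omega
      let v2 : HSlots := { v1 with sfe := encodeNat (keyOf nb w) }
      have h2 : Runs ((NS.op (.nrm (h .SFE)) : NS β).com) (base (hSt h T v1)) (base (hSt h T v2)) (30 * c) :=
        NS.runs_of_eq (N := n) _ _ (by simp only [NS.ok, NOp.ok, hSt_SFE, v1]; exact hlk) (by simp [v1, v2, norm_eq_encodeNat, keyOf]) (by simp [hc3])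
      have hlkey : (encodeNat (keyOf nb w)).length ≤ n := by
        have := Brick.length_encodeNat_bitsToNat_le (w.take nb); simp only [keyOf] at this ⊢; exact this.trans hlk
      let v3 : HSlots := { v2 with sfe := [], mnf := outRev ((E ++ (sw.take (L - (i + 1))).map fun w => encodeNat (keyOf nb w)) ++ [encodeNat (keyOf nb w)]) }
      have h3 : Runs (emit (Sum.inr (h .SFE)) (Sum.inr (h .MNF))) (base (hSt h T v2)) (base (hSt h T v3)) (4 * n + 3) := by
        refine (runs_emit (h := (Sum.inr (h .SFE) : EReg ⊕ β)) (o := Sum.inr (h .MNF)) (by simp [hq_ne h (show HReg.SFE ≠ .MNF by decide)]) (base (hSt h T v2))).of_eq ?_ ?_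
        · simp [v2, v3, v1, v0, st, outRev_append, -List.map_take, -List.map_drop, -List.append_assoc]
        · simp only [nst_inr, hSt_SFE, v2]; omega
      have h4 : Runs ((NS.op (.clear (h .FL1)) : NS β).com) (base (hSt h T v3)) (base (hSt h T (st i))) (3 * c) := by
        refine NS.runs_of_eq (N := n) _ _ (by simp only [NS.ok, NOp.ok, hSt_FL1, v3, v2, v1, List.length_cons, List.length_nil]; omega) ?_ (by simp [hc3])
        simp [v3, v2, v1, v0, st, htake, hwpl, ha2v, hsfe, hfl1, List.map_append, List.append_assoc, -List.map_take, -List.map_drop]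
      exact ⟨_, h1.seq (h2.seq (h3.seq h4)), by simp [st], by omega, rfl⟩)
    L (base (hSt h T (st L))) ⟨le_rfl, rfl⟩ (by simp [st])
  obtain ⟨R', hR, -, -, rfl⟩ := hK
  rw [← hstart] at hR
  refine hR.of_eq (by simp [st, hL, -List.map_take, -List.map_drop]) ?_
  simp only [decodeCost, ← hc3]; exact le_rfl

end MainOutput

section MainInit

/-! ### The main driver: initialisation

From `INP = enc N` with `nN = |enc N|`: `MNC := 1^{nN}` (the division rounds), `BLMU := nN + 1` (the
key width of the prime words), the number of trial divisors `2^{tE}` in unary on `U2`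
(`tE = ⌈nN/5⌉ + 1` above the threshold `n₀`, else `nN`: full trial division), `MN0 := N`; after the
trial division, `MNB := B = 2^{4|enc nN| + 8}` (the number of bases of the searches), `BLPOW := 2`,
the work stack `MNI` (the cofactor, unless it is `≤ 1`) and the round counter `INP := 1^7`. -/

/-- The threshold below which the machine factors by trial division alone. [folklore] -/
def n₀ : ℕ := 4096

/-- The exponent of the number of trial divisors. [folklore] -/
def tE (nN : ℕ) : ℕ := if n₀ ≤ nN then (nN + 4) / 5 + 1 else nN

/-- The exponent of the number of bases. [folklore] -/
def bE (nN : ℕ) : ℕ := (encodeNat nN).length * 4 + 8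

/-- Initialisation, part A (before the trial division). [folklore] -/
def initA : Com (EReg ⊕ β) :=
  ((NS.ofList [.len (h .X2) (h .INP) (h .X3), .toUnary (h .MNC) (h .X2), .succ (h .BLMU) (h .X2), .const (h .X3) (encodeNat n₀), .cmp (h .FL1) (h .X2) (h .X3), .clear (h .X3)] : NS β).com) ;;
  ((NS.ite (h .FL1) (NS.ofList [.const (h .X3) (encodeNat 4), .add (h .X4) (h .X2) (h .X3), .clear (h .X3), .const (h .X3) (encodeNat 5), .divMod (h .X5) (h .X6) (h .X4) (h .X3),
       .clear (h .X6), .clear (h .X4), .clear (h .X3), .succ (h .X4) (h .X5), .clear (h .X5)])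
     (NS.op (.copy (h .X2) (h .X4)))).com ;;
   (pow2Into (rGH h) (h .X5) (h .X4) ;; (((NS.op (.clear (h .X4))) : NS β).com ;; (nToUnary (h .U2) (h .X5) ;; ((NS.ofList [.clear (h .X5), .move (h .INP) (h .MN0)] : NS β).com)))))

/-- Cost of part A. [folklore] -/
def initACost (n nN : ℕ) : ℕ := 1500 * (n + 1) ^ 3 + (n * (16 * n + 21) + 3 * n + 7) + ((tE nN + 1) * (16 * 2 ^ tE nN + 21) + 5)

/-- **Initialisation, part A.** [folklore] -/
theorem runs_initA {N n : ℕ} (hn : 4 * (encodeNat N).length + 24 = n) (T : Regs β) (hI : DrvInv (rGH h) 0 T) (u : HSlots)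
    (hinp : u.inp = encodeNat N) (hx2 : u.x2 = []) (hx3 : u.x3 = []) (hx4 : u.x4 = []) (hx5 : u.x5 = []) (hx6 : u.x6 = []) (hfl1 : u.fl1 = []) (hmnc : u.mnc = []) (hblmu : u.blmu = [])
    (hu2 : u.u2 = []) (hmn0 : u.mn0 = []) :
    let nN := (encodeNat N).length
    Runs (initA h) (base (hSt h T u))
      (base (hSt h T { u with inp := [], x2 := encodeNat nN, mnc := List.replicate nN true, blmu := encodeNat (nN + 1), u2 := List.replicate (2 ^ tE nN) true, mn0 := encodeNat N })) (initACost n nN) := by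
  intro nN
  obtain ⟨-, -, -, -, -, -, -, -, -, -, hU, -, -, -, -, -, -, -⟩ := id hI
  have rdU : ∀ u' : HSlots, hSt h T u' ((rGH h) (.f (.n (.v .U)))) = [] := fun u' => by
    rw [rGH_apply, hSt_gv h T u' (by decide) (by decide) (by decide) (by decide) (by decide) (by decide)]; exact hU
  set c := (n + 1) ^ 3 with hc3
  have hnN : (encodeNat N).length = nN := rfl
  have hn8 : 8 ≤ n := by omega
  have hnNn : nN ≤ n := by omega
  have hlN : (encodeNat N).length ≤ n := by omega
  have hlnN : (encodeNat nN).length ≤ n := length_encodeNat_small (by omega) hn8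
  have hlnN1 : (encodeNat (nN + 1)).length ≤ n := length_encodeNat_small (by omega) hn8
  have hl4 : (encodeNat 4).length ≤ n := length_encodeNat_small (by omega) hn8
  have hl5 : (encodeNat 5).length ≤ n := length_encodeNat_small (by omega) hn8
  have hlnN4 : (encodeNat (nN + 4)).length ≤ n := length_encodeNat_small (by omega) hn8
  have hlq : (encodeNat ((nN + 4) / 5)).length ≤ n := length_encodeNat_small (by omega) hn8
  have hlr : (encodeNat ((nN + 4) % 5)).length ≤ n := length_encodeNat_small (by omega) hn8
  have hlq1 : (encodeNat ((nN + 4) / 5 + 1)).length ≤ n := length_encodeNat_small (by omega) hn8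
  have hln0 : (encodeNat n₀).length ≤ n := by rw [show n₀ = 2 ^ 12 by rfl, encodeNat_two_pow]; simp; omega
  have htEle : tE nN ≤ nN + 1 := by unfold tE; split_ifs <;> omega
  have hltE : (encodeNat (tE nN)).length ≤ n := length_encodeNat_small (by omega) hn8
  have hlT : (encodeNat (2 ^ tE nN)).length ≤ n := by rw [encodeNat_two_pow]; simp; omega
  -- block 1
  let u1 : HSlots := { u with x2 := encodeNat nN, mnc := List.replicate nN true, blmu := encodeNat (nN + 1), fl1 := flag (decide (n₀ ≤ nN)) }
  have h1 : Runs ((NS.ofList [.len (h .X2) (h .INP) (h .X3), .toUnary (h .MNC) (h .X2), .succ (h .BLMU) (h .X2), .const (h .X3) (encodeNat n₀), .cmp (h .FL1) (h .X2) (h .X3), .clear (h .X3)] : NS β).com)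
      (base (hSt h T u)) (base (hSt h T u1)) (268 * c) := by
    refine NS.runs_of_eq (N := n) _ _ ?_ ?_ (by simp [hc3])
    · simp (config := { decide := true }) only [NS.ofList, NS.ok, NOp.ok, NS.eval, NOp.eval, hSt_X2, hSt_INP, hSt_X3, hSt_MNC, hSt_BLMU, hSt_FL1, update_hSt_X2, update_hSt_X3, update_hSt_MNC, update_hSt_BLMU, update_hSt_FL1,
        hinp, hx2, hx3, hmnc, hblmu, hfl1, hnN, bitsToNat_encodeNat, ne_eq, EmbeddingLike.apply_eq_iff_eq, not_false_eq_true, List.length_nil, zero_le, and_self,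
        hlnN, hln0, hnNn]
    · simp [u1, hinp, hx3, hmnc, hblmu, hfl1, hnN, bitsToNat_encodeNat]
  -- block 2 (the exponent of the number of trial divisors)
  let u2 : HSlots := { u1 with fl1 := [], x4 := encodeNat (tE nN) }
  have h2 : Runs ((NS.ite (h .FL1) (NS.ofList [.const (h .X3) (encodeNat 4), .add (h .X4) (h .X2) (h .X3), .clear (h .X3), .const (h .X3) (encodeNat 5), .divMod (h .X5) (h .X6) (h .X4) (h .X3),
       .clear (h .X6), .clear (h .X4), .clear (h .X3), .succ (h .X4) (h .X5), .clear (h .X5)])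
     (NS.op (.copy (h .X2) (h .X4)))).com) (base (hSt h T u1)) (base (hSt h T u2)) (520 * c) := by
    by_cases hth : n₀ ≤ nN
    · refine NS.runs_of_eq (N := n) _ _ ?_ ?_ (by simp [hc3])
      · simp (config := { decide := true }) only [NS.ofList, NS.ok, NOp.ok, NS.eval, NOp.eval, hSt_FL1, hSt_X3, hSt_X4, hSt_X2, hSt_X5, hSt_X6, update_hSt_FL1, update_hSt_X3, update_hSt_X4, update_hSt_X5, update_hSt_X6,
          u1, hx3, hx4, hx5, hx6, hth, decide_true, flag_true, bitsToNat_encodeNat, ne_eq, EmbeddingLike.apply_eq_iff_eq, not_false_eq_true, List.length_nil, zero_le, and_self,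
          hl4, hl5, hlnN, hlnN4, hlq, hlr, and_true, true_or]
      · simp [u1, u2, hx3, hx4, hx5, hx6, hth, flag, bitsToNat_encodeNat, tE]
    · refine NS.runs_of_eq (N := n) _ _ ?_ ?_ (by simp [hc3])
      · simp (config := { decide := true }) only [NS.ofList, NS.ok, NOp.ok, NS.eval, NOp.eval, hSt_FL1, hSt_X2, u1, hx4, hth, decide_false, flag_false, ne_eq, EmbeddingLike.apply_eq_iff_eq,
          not_false_eq_true, hlnN, and_self, or_true, false_and, true_and]
      · simp [u1, u2, hx4, hth, flag, tE]
  -- the number of trial divisors, in unary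
  let u3 : HSlots := { u2 with x5 := encodeNat (2 ^ tE nN) }
  have h3 : Runs (pow2Into (rGH h) (h .X5) (h .X4)) (base (hSt h T u2)) (base (hSt h T u3)) (n * (16 * tE nN + 21) + 3 * tE nN + 7) := by
    have hne : h .X5 ≠ h .X4 := hq_ne h (by decide)
    have hneU : h .X5 ≠ (rGH h) (.f (.n (.v .U))) := (rGH_ne h .X5 (fun _ e => HReg.noConfusion e) _).symm
    have r1 : hSt h T u2 (h .X4) = encodeNat (tE nN) := by rw [hSt_X4]
    have r2 : hSt h T u2 (h .X5) = [] := by rw [hSt_X5]; exact hx5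
    refine (runs_pow2Into (rGH h) hneU hne hltE (hSt h T u2) r1 r2 (rdU u2)).of_eq (by rw [update_hSt_X5]) le_rfl
  let u4 : HSlots := { u3 with x4 := [] }
  have h4 : Runs ((NS.op (.clear (h .X4)) : NS β).com) (base (hSt h T u3)) (base (hSt h T u4)) (3 * c) :=
    NS.runs_of_eq (N := n) _ _ (by simp only [NS.ok, NOp.ok, hSt_X4, u3, u2]; exact hltE) (by simp [u3, u4]) (by simp [hc3])
  let u5 : HSlots := { u4 with u2 := List.replicate (2 ^ tE nN) true }
  have h5 : Runs (nToUnary (h .U2) (h .X5)) (base (hSt h T u4)) (base (hSt h T u5)) ((tE nN + 1) * (16 * 2 ^ tE nN + 21) + 5) := by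
    have hv : bitsToNat (encodeNat (2 ^ tE nN)) = 2 ^ tE nN := bitsToNat_encodeNat _
    have hl : (encodeNat (2 ^ tE nN)).length = tE nN + 1 := by rw [encodeNat_two_pow]; simp
    refine (runs_nToUnary (h .U2) (h .X5) (hSt h T u4) (by simp [u4, u3, u2, u1, hu2])).of_eq (by simp [u4, u5, u3, bitsToNat_encodeNat]) ?_
    rw [hSt_X5]; simp only [u4, u3, hv, hl]; exact le_rfl
  have h6 : Runs ((NS.ofList [.clear (h .X5), .move (h .INP) (h .MN0)] : NS β).com) (base (hSt h T u5))
      (base (hSt h T { u with inp := [], x2 := encodeNat nN, mnc := List.replicate nN true, blmu := encodeNat (nN + 1), u2 := List.replicate (2 ^ tE nN) true, mn0 := encodeNat N })) (11 * c) := by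
    refine NS.runs_of_eq (N := n) _ _ ?_ ?_ (by simp [hc3])
    · simp (config := { decide := true }) only [NS.ofList, NS.ok, NOp.ok, NS.eval, NOp.eval, hSt_X5, hSt_INP, update_hSt_X5, u5, u4, u3, u2, u1, hinp, ne_eq, EmbeddingLike.apply_eq_iff_eq, not_false_eq_true,
        hlT, hlN, and_self]
    · simp [u5, u4, u3, u2, u1, hinp, hmn0, hfl1, hx4, hx5]
  refine (h1.seq (h2.seq (h3.seq (h4.seq (h5.seq h6))))).of_eq rfl ?_
  have : n * (16 * tE nN + 21) + 3 * tE nN + 7 ≤ n * (16 * n + 21) + 3 * n + 7 := by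
    have := Nat.mul_le_mul_left n (show 16 * tE nN + 21 ≤ 16 * n + 21 by omega); omega
  simp only [initACost, ← hc3]; omega

/-- The initial work stack: the cofactor, unless `≤ 1`. [folklore] -/
def stack0 (Xf : ℕ) : List ℕ := if Xf ≤ 1 then [] else [Xf]

/-- Initialisation, part B (after the trial division): `B`, `BLPOW`, the work stack, the round counter. [folklore] -/
def initB : Com (EReg ⊕ β) :=
  ((NS.ofList [.len (h .X4) (h .X2) (h .X3), .const (h .X3) (encodeNat 4), .mul (h .X6) (h .X4) (h .X3), .clear (h .X4), .clear (h .X3), .const (h .X3) (encodeNat 8),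
      .add (h .X4) (h .X6) (h .X3), .clear (h .X6), .clear (h .X3), .clear (h .X2), .clear (h .MNC)] : NS β).com) ;;
  (pow2Into (rGH h) (h .MNB) (h .X4) ;; (((NS.ofList [.clear (h .X4), .const (h .BLPOW) (encodeNat 2), .const (h .X3) (encodeNat 1), .eq (h .FL2) (h .MN0) (h .X3) (h .X5), .clear (h .X3)]) : NS β).com ;;
  (Com.pop (Sum.inr (h .FL2)) ((NS.op (.clear (h .MN0))) : NS β).com skip skip ;; (whenCons h .MN0 (prependItem (rGH h) (h .MN0) (h .MNI)) skip ;; ((NS.op (.const (h .INP) (List.replicate 7 true))) : NS β).com))))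

/-- Cost of part B. [folklore] -/
def initBCost (n : ℕ) : ℕ := 610 * (n + 1) ^ 3 + (n * (16 * n + 21) + 3 * n + 7) + (10 * n + 10) + 10

/-- The block `BLPOW := 2`, `FL2 := [X = 1]` of part B, on abstract words. [folklore] -/
theorem runs_initB2 {n Xf : ℕ} (T : Regs β) (u : HSlots) (w1 w2 wX : List Bool) (hb1 : bitsToNat w1 = 1) (hbX : bitsToNat wX = Xf) (hl1 : w1.length ≤ n) (hl2 : w2.length ≤ n) (hlX : wX.length ≤ n)
    (hx4n : u.x4.length ≤ n) (hmn0 : u.mn0 = wX) (hx3 : u.x3 = []) (hx5 : u.x5 = []) (hfl2 : u.fl2 = []) (hblpow : u.blpow = []) :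
    Runs (((NS.ofList [.clear (h .X4), .const (h .BLPOW) w2, .const (h .X3) w1, .eq (h .FL2) (h .MN0) (h .X3) (h .X5), .clear (h .X3)]) : NS β).com) (base (hSt h T u))
      (base (hSt h T { u with x4 := [], blpow := w2, fl2 := flag (decide (Xf = 1)) })) (131 * (n + 1) ^ 3) := by
  refine NS.runs_of_eq (N := n) _ _ ?_ ?_ (by simp)
  · simp only [NS.ofList, NS.ok, NOp.ok, NS.eval, NOp.eval, hSt_X4, hSt_BLPOW, hSt_X3, hSt_FL2, hSt_MN0, hSt_X5, update_hSt_X4, update_hSt_BLPOW, update_hSt_X3, update_hSt_FL2, hx3, hx5, hfl2, hblpow, hmn0,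
      hb1, hbX, ne_eq, EmbeddingLike.apply_eq_iff_eq, not_false_eq_true, List.length_nil, zero_le, and_self, hl2, hl1, hlX, hx4n, reduceCtorEq]
  · simp [hx3, hx5, hfl2, hblpow, hmn0, hb1, hbX]

/-- **Initialisation, part B.** [folklore] -/
theorem runs_initB {N n Xf : ℕ} (hn : 4 * (encodeNat N).length + 24 = n) (hXf : Xf ≤ N) (T : Regs β) (hI : DrvInv (rGH h) 0 T) (u : HSlots) (htmph : u.gw.tmph = [])
    (hx2 : u.x2 = encodeNat (encodeNat N).length) (hmnc : u.mnc = List.replicate (encodeNat N).length true) (hmn0 : u.mn0 = encodeNat Xf)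
    (hx3 : u.x3 = []) (hx4 : u.x4 = []) (hx5 : u.x5 = []) (hx6 : u.x6 = []) (hfl2 : u.fl2 = []) (hmnb : u.mnb = []) (hblpow : u.blpow = []) (hmni : u.mni = []) (hinp : u.inp = []) :
    Runs (initB h) (base (hSt h T u))
      (base (hSt h T { u with x2 := [], mnc := [], mn0 := [], mnb := encodeNat (2 ^ bE (encodeNat N).length), blpow := encodeNat 2, mni := encVec (stack0 Xf), inp := List.replicate 7 true })) (initBCost n) := by
  obtain ⟨-, -, -, -, -, -, -, -, -, -, hU, -, -, -, -, -, -, -⟩ := id hI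
  have rdU : ∀ u' : HSlots, hSt h T u' ((rGH h) (.f (.n (.v .U)))) = [] := fun u' => by
    rw [rGH_apply, hSt_gv h T u' (by decide) (by decide) (by decide) (by decide) (by decide) (by decide)]; exact hU
  set c := (n + 1) ^ 3 with hc3
  set nN := (encodeNat N).length with hnN0
  have hn8 : 8 ≤ n := by omega
  have hnNn : nN ≤ n := by omega
  have hlnN : (encodeNat nN).length ≤ n := length_encodeNat_small (by omega) hn8
  have hlnN4 : (encodeNat nN).length ≤ nN := length_encodeNat_le_self _
  have hl4 : (encodeNat 4).length ≤ n := length_encodeNat_small (by omega) hn8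
  have hl8 : (encodeNat 8).length ≤ n := length_encodeNat_small (by omega) hn8
  have hllen : (encodeNat (encodeNat nN).length).length ≤ n := length_encodeNat_small (by omega) hn8
  have hlm4 : (encodeNat ((encodeNat nN).length * 4)).length ≤ n := by
    have : (encodeNat nN).length * 4 ≤ 2 ^ (n - 1) := by
      have h8 : ∀ k, 4 * (8 + k) ≤ 2 ^ (7 + k) := fun k => by
        induction k with
        | zero => norm_num
        | succ k ih => rw [show 7 + (k + 1) = (7 + k) + 1 by omega, pow_succ]; omega
      have := h8 (n - 8); rw [show 7 + (n - 8) = n - 1 by omega] at this; omega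
    exact (length_encodeNat_le_succ this).trans (by omega)
  have hbE : bE nN ≤ n - 15 := by unfold bE; omega
  have hlbE : (encodeNat (bE nN)).length ≤ n := (length_encodeNat_le_self _).trans (by omega)
  have hlX : (encodeNat Xf).length ≤ n := (Brick.length_encodeNat_mono hXf).trans (by omega)
  have e1 : encodeNat 1 = [true] := by simpa using encodeNat_two_pow 0
  have hl1 : (encodeNat 1).length ≤ n := by rw [e1]; simp only [List.length_cons, List.length_nil]; omega
  have hl2 : (encodeNat 2).length ≤ n := length_encodeNat_small (by omega) hn8
  -- block 1: the exponent of `B`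
  let u1 : HSlots := { u with x2 := [], mnc := [], x4 := encodeNat (bE nN) }
  have h1 : Runs ((NS.ofList [.len (h .X4) (h .X2) (h .X3), .const (h .X3) (encodeNat 4), .mul (h .X6) (h .X4) (h .X3), .clear (h .X4), .clear (h .X3), .const (h .X3) (encodeNat 8),
      .add (h .X4) (h .X6) (h .X3), .clear (h .X6), .clear (h .X3), .clear (h .X2), .clear (h .MNC)] : NS β).com) (base (hSt h T u)) (base (hSt h T u1)) (465 * c) := by
    refine NS.runs_of_eq (N := n) _ _ ?_ ?_ (by simp [hc3])
    · simp (config := { decide := true }) only [NS.ofList, NS.ok, NOp.ok, NS.eval, NOp.eval, hSt_X4, hSt_X2, hSt_X3, hSt_X6, hSt_MNC, update_hSt_X4, update_hSt_X3, update_hSt_X6, update_hSt_X2, hx2, hx3, hx4, hx6, hmnc,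
        bitsToNat_encodeNat, ne_eq, EmbeddingLike.apply_eq_iff_eq, not_false_eq_true, List.length_nil, List.length_replicate, zero_le, and_self, hlnN, hl4, hl8, hllen, hlm4, hnNn]
    · simp [u1, hx2, hx3, hx6, hmnc, bitsToNat_encodeNat, bE]
  -- `B`
  let u2 : HSlots := { u1 with mnb := encodeNat (2 ^ bE nN) }
  have h2 : Runs (pow2Into (rGH h) (h .MNB) (h .X4)) (base (hSt h T u1)) (base (hSt h T u2)) (n * (16 * bE nN + 21) + 3 * bE nN + 7) := by
    have hne : h .MNB ≠ h .X4 := hq_ne h (by decide)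
    have hneU : h .MNB ≠ (rGH h) (.f (.n (.v .U))) := (rGH_ne h .MNB (fun _ e => HReg.noConfusion e) _).symm
    have r1 : hSt h T u1 (h .X4) = encodeNat (bE nN) := by rw [hSt_X4]
    have r2 : hSt h T u1 (h .MNB) = [] := by rw [hSt_MNB]; exact hmnb
    refine (runs_pow2Into (rGH h) hneU hne hlbE (hSt h T u1) r1 r2 (rdU u1)).of_eq (by rw [update_hSt_MNB]) le_rfl
  -- block 2: `BLPOW`, the test `Xf = 1`
  let u3 : HSlots := { u2 with x4 := [], blpow := encodeNat 2, fl2 := flag (decide (Xf = 1)) }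
  have h3 : Runs (((NS.ofList [.clear (h .X4), .const (h .BLPOW) (encodeNat 2), .const (h .X3) (encodeNat 1), .eq (h .FL2) (h .MN0) (h .X3) (h .X5), .clear (h .X3)]) : NS β).com) (base (hSt h T u2)) (base (hSt h T u3)) (131 * c) :=
    runs_initB2 h (Xf := Xf) T u2 (encodeNat 1) (encodeNat 2) (encodeNat Xf) (bitsToNat_encodeNat 1) (bitsToNat_encodeNat Xf) hl1 hl2 hlX (by simp only [u2, u1]; exact hlbE) (by simp [u2, u1, hmn0])
      (by simp [u2, u1, hx3]) (by simp [u2, u1, hx5]) (by simp [u2, u1, hfl2]) (by simp [u2, u1, hblpow])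
  -- block 3: the stack
  have hT : ∀ u' : HSlots, u'.gw.tmph = [] → hSt h T u' ((rGH h) .TMPH) = [] := fun u' h0 => by rw [rGH_apply, hSt_gTMPH]; exact h0
  let u4 : HSlots := { u3 with fl2 := [], mn0 := (if Xf = 1 then [] else encodeNat Xf) }
  have h4 : Runs (Com.pop (Sum.inr (h .FL2)) ((NS.op (.clear (h .MN0))) : NS β).com skip skip) (base (hSt h T u3)) (base (hSt h T u4)) (3 * c + 2) := by
    by_cases h1X : Xf = 1
    · have hA : Runs ((NS.op (.clear (h .MN0)) : NS β).com) (base (hSt h T { u3 with fl2 := [] })) (base (hSt h T u4)) (3 * c) := by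
        refine NS.runs_of_eq (N := n) _ _ (by simp only [NS.ok, NOp.ok, hSt_MN0, u3, u2, u1, hmn0]; exact hlX) ?_ (by simp [hc3])
        simp [u4, u3, h1X]
      exact Runs.opop_true (k := h .FL2) (ct := ((NS.op (.clear (h .MN0))) : NS β).com) skip skip (T := hSt h T u3) (w := []) (by simp [u3, h1X, flag]) (by rw [update_hSt_FL2]; exact hA)
    · have hst : hSt h T u3 = hSt h T u4 := by simp [u3, u4, u2, u1, h1X, flag, hmn0]
      exact (Runs.opop_nil (k := h .FL2) ((NS.op (.clear (h .MN0))) : NS β).com skip (T := hSt h T u3) (by simp [u3, h1X, flag]) (Runs.skip _)).of_eq (by rw [hst]) (by omega)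
  let u5 : HSlots := { u4 with mn0 := [], mni := encVec (stack0 Xf) }
  have h5 : Runs (whenCons h .MN0 (prependItem (rGH h) (h .MN0) (h .MNI)) skip) (base (hSt h T u4)) (base (hSt h T u5)) ((10 * n + 10) + 3) := by
    by_cases hle : Xf ≤ 1
    · have hmn : u4.mn0 = [] := by
        simp only [u4]; split_ifs with h1
        · rfl
        · have : Xf = 0 := by omega
          rw [this]; rfl
      have hF : hSt h T u4 (h .MN0) = [] := by rw [hSt_MN0]; exact hmn
      have hst : hSt h T u4 = hSt h T u5 := by
        have h45 : u5 = { ({ u4 with mn0 := [] } : HSlots) with mni := [] } := by simp [u5, stack0, hle, encVec]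
        have hMNI : hSt h T u4 (h .MNI) = [] := by rw [hSt_MNI]; simp [u4, u3, u2, u1, hmni]
        rw [h45, ← update_hSt_MNI, ← update_hSt_MN0]
        rw [Function.update_eq_self_iff.2 (by rw [Function.update_of_ne (hq_ne h (by decide))]; exact hMNI.symm), Function.update_eq_self_iff.2 hF.symm]
      exact (runs_whenCons_nil h .MN0 (prependItem (rGH h) (h .MN0) (h .MNI)) (hSt h T u4) hF (Runs.skip _)).of_eq (by rw [hst]) (by omega)
    · have hmn : u4.mn0 = encodeNat Xf := by simp only [u4]; rw [if_neg (by omega)]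
      obtain ⟨bb, w, hbw⟩ := encodeNat_eq_cons (show 0 < Xf by omega)
      have hs : stack0 Xf = [Xf] := by simp [stack0]; omega
      have hP : Runs (prependItem (rGH h) (h .MN0) (h .MNI)) (base (hSt h T u4)) (base (hSt h T u5)) (10 * n + 10) := by
        refine (runs_prependItem (rGH h) (src := h .MN0) (dst := h .MNI) (rGH_ne h .MN0 (fun _ e => HReg.noConfusion e) _).symm (rGH_ne h .MNI (fun _ e => HReg.noConfusion e) _).symm
          (hq_ne h (by decide)) (hSt h T u4) (hT _ (by simp [u4, u3, u2, u1, htmph]))).of_eq ?_ ?_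
        · rw [update_hSt_MN0, update_hSt_MNI, hSt_MN0, hmn]; simp [u5, u4, u3, u2, u1, hmni, hs, encVec, encList_cons_eq_dbl]
        · rw [hSt_MN0, hmn]; omega
      exact (runs_whenCons_cons h .MN0 skip (hSt h T u4) (bb := bb) (w := w) (by rw [hSt_MN0, hmn, hbw]) hP).of_eq rfl (by omega)
  have h6 : Runs ((NS.op (.const (h .INP) (List.replicate 7 true)) : NS β).com) (base (hSt h T u5))
      (base (hSt h T { u with x2 := [], mnc := [], mn0 := [], mnb := encodeNat (2 ^ bE (encodeNat N).length), blpow := encodeNat 2, mni := encVec (stack0 Xf), inp := List.replicate 7 true })) (4 * c) := by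
    refine NS.runs_of_eq (N := n) _ _ ?_ ?_ (by simp [hc3])
    · simp only [NS.ok, NOp.ok, hSt_INP, u5, u4, u3, u2, u1, hinp, List.length_nil, List.length_replicate]; omega
    · simp [u5, u4, u3, u2, u1, hnN0, hx4, hfl2]
  refine (h1.seq (h2.seq (h3.seq (h4.seq (h5.seq h6))))).of_eq rfl ?_
  have : n * (16 * bE nN + 21) + 3 * bE nN + 7 ≤ n * (16 * n + 21) + 3 * n + 7 := by
    have := Nat.mul_le_mul_left n (show 16 * bE nN + 21 ≤ 16 * n + 21 by omega); omega
  simp only [initBCost, ← hc3]; omega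

end MainInit

section MainAssembly

/-! ### The main driver: the output assembled, and the whole machine -/

/-- The output: the primes of the rounds to words, the sort, the decoding, the clean-up, `OUTP`. [folklore] -/
def outputProg : Com (EReg ⊕ β) :=
  ((NS.ofList [.copy (h .BLMU) (h .A2D), .toUnary (h .A2U) (h .A2D)]) : NS β).com ;; (wordsPass h ;; (setMDw h ;; (a2Sort h ;; (decode h ;;
  (((NS.ofList [.clear (h (.g (.f (.n (.v .MD))))), .clear (h .A2D), .clear (h .A2U), .clear (h .BLMU), .clear (h .MNB), .clear (h .BLPOW)]) : NS β).com ;;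
   (clear (Sum.inr (h .MNI)) ;; pour (Sum.inr (h .MNF)) (Sum.inr (h .OUTP))))))))

/-- The sorted primes of the rounds, as decoded from the sorted words. [folklore] -/
def sortedKeys (nb : ℕ) (ps : List ℕ) : List ℕ := (radixIter (primeWords nb ps) nb).map fun w => keyOf nb w

/-- Cost of the output on `P` primes of the rounds, a leftover stack code of length `K`, an output code of length `M`. [folklore] -/
def outputCost (n nN P K M : ℕ) (ws : List (List Bool)) : ℕ :=
  55 * (n + 1) ^ 3 + (wordsPassCost n P + ((90 * (n + 1) ^ 3 + (n * (16 * n + 21) + 3 * n + 7)) + (a2SortCost n (nN + 1) ws + (decodeCost n (nN + 1) P + (18 * (n + 1) ^ 3 + ((2 * K + 1) + (3 * M + 1)))))))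

/-- The words of the primes have the expected shape. [folklore] -/
theorem primeWords_shape {nb : ℕ} {ps : List ℕ} (hps : ∀ p ∈ ps, (encodeNat p).length ≤ nb) :
    ∀ w ∈ primeWords nb ps, nb ≤ w.length ∧ w.length ≤ nb + 1 ∧ payloadOf nb w = [] := by
  intro w hw
  simp only [primeWords, List.mem_map] at hw
  obtain ⟨p, hp, rfl⟩ := hw
  obtain ⟨-, -, hpl, hlen, -⟩ := mkWord_split (hps p hp) false []
  refine ⟨hlen, ?_, hpl⟩
  simp only [mkWord, List.length_append, List.length_replicate, List.length_cons, List.length_nil]; have := hps p hp; omega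

/-- **The output.** [folklore] -/
theorem runs_output {N n : ℕ} (hn : 4 * (encodeNat N).length + 24 = n) (T : Regs β) (hI : DrvInv (rGH h) 0 T) (u : HSlots)
    (stk ps small : List ℕ) (hps : ∀ p ∈ ps, p ≤ N) (B : ℕ) (hlB : (encodeNat B).length ≤ n)
    (hmni : u.mni = encVec stk) (hl3 : u.l3 = encVec ps) (hmnc : u.mnc = List.replicate ps.length true) (hmnf : u.mnf = outRev (small.map encodeNat))
    (hblmu : u.blmu = encodeNat ((encodeNat N).length + 1)) (hmnb : u.mnb = encodeNat B) (hblpow : u.blpow = encodeNat 2) (houtp : u.outp = [])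
    (ha2d : u.a2d = []) (ha2u : u.a2u = []) (ha2t : u.a2t = []) (hx5 : u.x5 = []) (ha2v : u.a2v = []) (hx2 : u.x2 = []) (hx3 : u.x3 = []) (hx4 : u.x4 = []) (hu2 : u.u2 = []) (hl4 : u.l4 = [])
    (ha2l1 : u.a2l1 = []) (hrx1 : u.rx1 = []) (ha2srt : u.a2srt = []) (hrx2 : u.rx2 = []) (hrx3 : u.rx3 = []) (hrx4 : u.rx4 = []) (hrx5 : u.rx5 = []) (hrx6 : u.rx6 = []) (hrx7 : u.rx7 = []) (hrx8 : u.rx8 = [])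
    (hrx9 : u.rx9 = []) (hsfk : u.sfk = []) (hsfe : u.sfe = []) (hfl1 : u.fl1 = []) :
    let nN := (encodeNat N).length
    Runs (outputProg h) (base (hSt h T u))
      (base (hSt h T { u with mni := [], l3 := [], mnc := [], mnf := [], blmu := [], mnb := [], blpow := [], outp := encVec (small ++ sortedKeys (nN + 1) ps) }))
      (outputCost n nN ps.length (encVec stk).length (encVec (small ++ sortedKeys (nN + 1) ps)).length (primeWords (nN + 1) ps)) := by
  intro nN
  set c := (n + 1) ^ 3 with hc3
  have hnN : (encodeNat N).length = nN := rfl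
  set nb := nN + 1 with hnb0
  set Nw := 2 ^ nN with hNw
  have hnbW : (encodeNat Nw).length = nb := by rw [hNw, encodeNat_two_pow]; simp [hnb0]
  have hnw : 2 * (encodeNat Nw).length + 8 ≤ n := by rw [hnbW]; omega
  have hNwN : N < Nw := by
    rw [hNw, ← hnN, TM2Pass.length_encodeNat_eq_size]; exact Nat.lt_size_self N
  have hpsw : ∀ p ∈ ps, p < Nw := fun p hp => lt_of_le_of_lt (hps p hp) hNwN
  have hpsl : ∀ p ∈ ps, (encodeNat p).length ≤ nb := fun p hp => by
    have := Brick.length_encodeNat_mono (hps p hp); omega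
  have hnbn : nb ≤ n := by omega
  have hlnb : (encodeNat nb).length ≤ n := (length_encodeNat_le_self _).trans hnbn
  -- `A2D`, `A2U`
  let u1 : HSlots := { u with a2d := encodeNat nb, a2u := List.replicate nb true }
  have h1 : Runs (((NS.ofList [.copy (h .BLMU) (h .A2D), .toUnary (h .A2U) (h .A2D)]) : NS β).com) (base (hSt h T u)) (base (hSt h T u1)) (55 * c) := by
    refine NS.runs_of_eq (N := n) _ _ ?_ ?_ (by simp [hc3])
    · simp (config := { decide := true }) only [NS.ofList, NS.ok, NOp.ok, NS.eval, NOp.eval, hSt_BLMU, hSt_A2D, hSt_A2U, update_hSt_A2D, hblmu, ha2d, ha2u, bitsToNat_encodeNat, ne_eq, EmbeddingLike.apply_eq_iff_eq,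
        not_false_eq_true, List.append_nil, hlnb, hnbn, and_self]
    · simp [u1, hblmu, ha2d, ha2u, bitsToNat_encodeNat, hnb0]
  -- the words
  have h2 := runs_wordsPass h (Nw := Nw) (nb := nb) hnw hnbW T hI u1 ps hpsw (by simp [u1]) (by simp [u1, ha2t]) (by simp [u1, hx5]) (by simp [u1, ha2v]) (by simp [u1, hx2]) (by simp [u1, hx3]) (by simp [u1, hu2])
    (by simp [u1, hl4]) (by simp [u1, ha2l1])
  have hst2 : ({ u1 with l3 := encVec ps, mnc := List.replicate ps.length true } : HSlots) = u1 := by simp [u1, hl3, hmnc]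
  rw [hst2] at h2
  let u2 : HSlots := { u1 with l3 := [], mnc := [], l4 := outRev (primeWords nb ps), a2l1 := List.replicate ps.length true }
  -- the modulus register
  have h3 := runs_setMDw h (n := n) (nN := nN) (by omega) T hI u2 (by simp [u2, u1, hnb0]) (by simp [u2, u1, hx2]) (by simp [u2, u1, hx3]) (by simp [u2, u1, hx4])
  set T' := Function.update T (h (.g (.f (.n (.v .MD))))) (encodeNat (2 ^ nN)) with hT'
  have hI' : DrvInv (rGH h) Nw T' := by rw [hT', hNw]; exact drvInv_setMD h hI
  let u3 : HSlots := { u2 with x2 := [], x4 := [] }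
  -- the sort
  have h4 := runs_a2Sort h (n := n) (nb := nb) (by omega) (primeWords nb ps) T' u3 (by simp [u3, u2]) (by simp [u3, u2, u1]) (by simp [u3, u2, u1, hrx1]) (by simp [u3, u2, u1, ha2srt]) (by simp [u3, u2, u1, hrx2])
    (by simp [u3, u2, u1, hrx3]) (by simp [u3, u2, u1, hrx4]) (by simp [u3, u2, u1, hrx5]) (by simp [u3, u2, u1, hrx6]) (by simp [u3, u2, u1, hrx7]) (by simp [u3, u2, u1, hrx8]) (by simp [u3, u2, u1, hrx9])
  let u4 : HSlots := { u3 with l4 := [], rx1 := encList (radixIter (primeWords nb ps) nb) }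
  -- the decoding
  have hswlen : (radixIter (primeWords nb ps) nb).length = ps.length := by rw [length_radixIter]; simp [primeWords]
  have hsw : ∀ w ∈ radixIter (primeWords nb ps) nb, nb ≤ w.length ∧ w.length ≤ nb + 1 ∧ payloadOf nb w = [] := fun w hw =>
    primeWords_shape hpsl w ((radixIter_perm _ _).subset hw)
  have h5 := runs_decode h (Nw := Nw) (nb := nb) hnw hnbW T' hI' u4 (radixIter (primeWords nb ps) nb) hsw (small.map encodeNat)
    (by simp [u4, u3, u2, u1]) (by simp [u4, u3, u2, u1, ha2v]) (by simp [u4, u3, u2, u1, hsfk]) (by simp [u4, u3, u2, u1, hsfe]) (by simp [u4, u3, u2, u1, hfl1]) (by simp [u4, u3, u2, u1, hu2])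
  have hst5 : ({ u4 with rx1 := encList (radixIter (primeWords nb ps) nb), a2l1 := List.replicate (radixIter (primeWords nb ps) nb).length true, mnf := outRev (small.map encodeNat) } : HSlots) = u4 := by
    simp [u4, u3, u2, u1, hmnf, hswlen]
  rw [hst5] at h5
  have hkeys : small.map encodeNat ++ (radixIter (primeWords nb ps) nb).map (fun w => encodeNat (keyOf nb w)) = (small ++ sortedKeys nb ps).map encodeNat := by
    simp [sortedKeys, List.map_append, List.map_map, Function.comp_def]
  let u5 : HSlots := { u4 with rx1 := [], a2l1 := [], mnf := outRev ((small ++ sortedKeys nb ps).map encodeNat) }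
  have h5' := h5.of_eq (R' := base (hSt h T' u5)) (by rw [hkeys]) le_rfl
  -- clean-up
  have hMD : T (h (.g (.f (.n (.v .MD))))) = [] := by
    obtain ⟨h0, -⟩ := id hI; rw [rGH_apply] at h0; exact h0
  have hTT : Function.update T' (h (.g (.f (.n (.v .MD))))) [] = T := by rw [hT', Function.update_idem, Function.update_eq_self_iff]; exact hMD.symm
  have hl2N : (encodeNat (2 ^ nN)).length ≤ n := by rw [encodeNat_two_pow]; simp; omega
  have hl2 : (encodeNat 2).length ≤ n := by rw [show (2 : ℕ) = 2 ^ 1 by norm_num, encodeNat_two_pow]; simp; omega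
  let u6 : HSlots := { u5 with a2d := [], a2u := [], blmu := [], mnb := [], blpow := [] }
  have h6 : Runs (((NS.ofList [.clear (h (.g (.f (.n (.v .MD))))), .clear (h .A2D), .clear (h .A2U), .clear (h .BLMU), .clear (h .MNB), .clear (h .BLPOW)]) : NS β).com) (base (hSt h T' u5)) (base (hSt h T u6)) (18 * c) := by
    refine NS.runs_of_eq (N := n) _ _ ?_ ?_ (by simp [hc3])
    · simp only [NS.ofList, NS.ok, NOp.ok, NS.eval, NOp.eval, hSt_MD, hSt_A2D, hSt_A2U, hSt_BLMU, hSt_MNB, hSt_BLPOW, update_hSt_MD, update_hSt_A2D, update_hSt_A2U, update_hSt_BLMU, update_hSt_MNB,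
        u5, u4, u3, u2, u1, hblmu, hmnb, hblpow, hT', Function.update_self, List.length_replicate]
      exact ⟨hl2N, hlnb, by omega, hlnb, hlB, hl2, trivial⟩
    · simp only [NS.ofList, NS.eval, NOp.eval, update_hSt_MD, hTT, update_hSt_A2D, update_hSt_A2U, update_hSt_BLMU, update_hSt_MNB, update_hSt_BLPOW, u6]
  -- the leftover stack, `OUTP`
  let u7 : HSlots := { u6 with mni := [] }
  have h7 : Runs (clear (Sum.inr (h .MNI))) (base (hSt h T u6)) (base (hSt h T u7)) (2 * (encVec stk).length + 1) := by
    refine (runs_oclear (h .MNI) (hSt h T u6)).of_eq (by rw [update_hSt_MNI]) ?_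
    simp only [hSt_MNI, u6, u5, u4, u3, u2, u1, hmni]; exact le_rfl
  have h8 : Runs (pour (Sum.inr (h .MNF)) (Sum.inr (h .OUTP))) (base (hSt h T u7))
      (base (hSt h T { u with mni := [], l3 := [], mnc := [], mnf := [], blmu := [], mnb := [], blpow := [], outp := encVec (small ++ sortedKeys (nN + 1) ps) })) (3 * (encVec (small ++ sortedKeys (nN + 1) ps)).length + 1) := by
    have hrev : (outRev (small.map encodeNat ++ (sortedKeys nb ps).map encodeNat)).reverse = encVec (small ++ sortedKeys nb ps) := by rw [← List.map_append]; exact reverse_outRev_map _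
    have hlen : (outRev ((small ++ sortedKeys nb ps).map encodeNat)).length = (encVec (small ++ sortedKeys nb ps)).length := by rw [← reverse_outRev_map, List.length_reverse]
    refine (runs_opour (a := h .MNF) (b := h .OUTP) (hq_ne h (by decide)) (hSt h T u7)).of_eq ?_ ?_
    · rw [update_hSt_MNF, update_hSt_OUTP]; simp [u7, u6, u5, u4, u3, u2, u1, houtp, hrev, ← hnb0, ha2d, ha2u, hx2, hx4, hl4, hrx1, ha2l1]
    · simp only [hSt_MNF, u7, u6, u5, ← hnb0, hlen]; exact le_rfl
  refine (h1.seq (h2.seq (h3.seq (h4.seq (h5'.seq (h6.seq (h7.seq h8))))))).of_eq rfl ?_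
  simp only [outputCost, ← hc3, ← hnb0, hswlen]; omega

/-- The empty level-pass record. [folklore] -/
def eF : FSlots := ⟨[], [], [], [], [], [], [], [], [], [], [], [], [], [], [], []⟩

/-- The empty driver record. [folklore] -/
def eG : GSlots := ⟨[], [], [], [], [], [], [], [], [], [], [], [], [], [], [], [], [], [], [], [], [], [], [], [], eF⟩

/-- The empty record of the machine's variables. [folklore] -/
def eH : HSlots := ⟨[], [], [], [], [], [], [], [], [], [], [], [], [], [], [], [], [], [], [], [], [], [], [], [], [], [], [], [], [], [], [], [], [], [], [], [], [], [], [], [], [], [], [], [], [], [], [], [], [], [], [], [], [], [], [], [], [], [], [], [], [], [], [], [], [], [], [], [], [], [], [], [], [], [], [], [], [], [], [], [], [], [], [], [], [], [], [], [], eG⟩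

/-- The empty driver record is clean. [folklore] -/
theorem eG_clean : eG.Clean := by simp [GSlots.Clean, eG, eF]

/-- **The factoring machine**: initialisation, trial division, the rounds of the work stack, the output. [folklore] -/
def mainProg : Com (EReg ⊕ β) := initA h ;; (tdiv h ;; (initB h ;; (rounds h ;; outputProg h)))

/-- The number of trial divisors `2^{tE}` and the trial division's result. [folklore] -/
def tdOf (N : ℕ) : ℕ × List ℕ := tdRun N (encodeNat N).length (2 ^ tE (encodeNat N).length)

/-- The number of bases `B`. [folklore] -/
def bOf (N : ℕ) : ℕ := 2 ^ bE (encodeNat N).length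

/-- The state of the work stack after the seven rounds. [folklore] -/
def roundsOf (N : ℕ) : List ℕ × List ℕ := roundsRun (bOf N) (stack0 (tdOf N).1, []) 7

/-- **The output of the factoring machine**: the small prime factors found by trial division followed
by the sorted keys of the primes found by the rounds. [folklore] -/
def factorOut (N : ℕ) : List ℕ := (tdOf N).2 ++ sortedKeys ((encodeNat N).length + 1) (roundsOf N).2

/-- The register size parameter of the cost bounds. [folklore] -/
def nPar (N : ℕ) : ℕ := 4 * (encodeNat N).length + 24

/-- Cost of the factoring machine on `N`. [folklore] -/
def mainCost (N : ℕ) : ℕ :=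
  let nN := (encodeNat N).length
  let n := nPar N
  initACost n nN + (tdivCost n nN (2 ^ tE nN) + (initBCost n + (roundsCost n (bOf N) 7 (stack0 (tdOf N).1, []) +
    outputCost n nN (roundsOf N).2.length (encVec (roundsOf N).1).length (encVec (factorOut N)).length (primeWords (nN + 1) (roundsOf N).2))))

/-- **The factoring machine on the stack machine**: from `INP = enc N` (all else empty) to
`OUTP = encVec (factorOut N)` (all else empty), within `mainCost N` steps — provided every number the
rounds meet is good (`GoodX`) and every prime they report is `≤ N` (both established separately, from
the arithmetic of the per-number procedure). [folklore] -/
theorem runs_main (N : ℕ) (T : Regs β) (hI : DrvInv (rGH h) 0 T) (hC0 : T (h (.g .CINV)) = [])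
    (hinv : ∀ k, k ≤ 7 → ∀ X ∈ (roundsRun (bOf N) (stack0 (tdOf N).1, []) k).1, GoodX (nPar N) (bOf N) X)
    (hps : ∀ p ∈ (roundsOf N).2, p ≤ N) :
    Runs (mainProg h) (base (hSt h T { eH with inp := encodeNat N })) (base (hSt h T { eH with outp := encVec (factorOut N) })) (mainCost N) := by
  set nN := (encodeNat N).length with hnN0
  set n := nPar N with hn0
  have hn : 4 * (encodeNat N).length + 24 = n := by rw [hn0, nPar]
  set Tn := 2 ^ tE nN with hTn0
  set B := bOf N with hB0
  have hBE : B = 2 ^ bE (encodeNat N).length := by rw [hB0, bOf]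
  -- initialisation A
  have h1 := runs_initA h (N := N) hn T hI { eH with inp := encodeNat N } rfl rfl rfl rfl rfl rfl rfl rfl rfl rfl rfl
  rw [← hnN0] at h1
  -- trial division
  have hTn : (encodeNat (Tn + 2)).length ≤ n := by
    have h1' : Tn + 2 ≤ 2 ^ (tE nN + 2) := by
      rw [hTn0, pow_add]; have := Nat.one_le_two_pow (n := tE nN); nlinarith
    have h2' : tE nN ≤ nN + 1 := by unfold tE; split_ifs <;> omega
    exact (length_encodeNat_le_succ h1').trans (by omega)
  let uA : HSlots := { eH with inp := [], x2 := encodeNat nN, mnc := List.replicate nN true, blmu := encodeNat (nN + 1), mn0 := encodeNat N }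
  have h2 := runs_tdiv h (N := N) (n := n) (nb := nN) (Tn := Tn) (by omega) (by omega) hTn T uA rfl rfl rfl rfl rfl rfl rfl rfl rfl rfl rfl
  have hst2 : ({ uA with u2 := List.replicate Tn true } : HSlots) = { ({ eH with inp := encodeNat N } : HSlots) with inp := [], x2 := encodeNat nN, mnc := List.replicate nN true, blmu := encodeNat (nN + 1), u2 := List.replicate (2 ^ tE nN) true, mn0 := encodeNat N } := by
    simp [uA, hTn0]
  rw [hst2] at h2
  have htd : tdRun N nN Tn = tdOf N := by rw [tdOf, ← hnN0, hTn0]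
  rw [htd] at h2
  -- initialisation B
  let uT : HSlots := { uA with u2 := [], mn0 := encodeNat (tdOf N).1, mnf := outRev ((tdOf N).2.map encodeNat) }
  have hXf : (tdOf N).1 ≤ N := by rw [← htd]; exact (tdRun_facts N nN Tn).1
  have h3 := runs_initB h (N := N) (Xf := (tdOf N).1) hn hXf T hI uT rfl (by simp [uT, uA, ← hnN0]) (by simp [uT, uA, ← hnN0]) rfl rfl rfl rfl rfl rfl rfl rfl rfl rfl
  rw [← hBE] at h3
  -- the rounds
  let uB : HSlots := { uT with x2 := [], mnc := [], mn0 := [], mnb := encodeNat B, blpow := encodeNat 2, mni := [], inp := [] }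
  have hlB : (encodeNat B).length ≤ n := by
    rw [hBE, encodeNat_two_pow]; simp
    have : bE (encodeNat N).length ≤ n - 15 := by
      unfold bE; have := length_encodeNat_le_self (encodeNat N).length; omega
    omega
  have hinv' : ∀ k, k ≤ 7 → ∀ X ∈ (roundsRun B (stack0 (tdOf N).1, []) k).1, GoodX n B X := by rw [hB0, hn0]; exact hinv
  have h4 := runs_rounds h (n := n) (B := B) (R := 7) (stack0 (tdOf N).1, []) hinv' T hI hC0 uB eG_clean (by simp [uB, uT, uA, eH, eG]) (by simp [uB, uT, uA, eH, eG]) (by simp [uB, uT, uA, eH, eG]) (by simp [uB, uT, uA, eH, eG]) (by simp [uB, uT, uA, eH, eG]) hlB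
    (by simp [uB]) (by simp [uB]) (by simp [uB]) (by simp [uB, uT, uA, eH]) (by simp [uB, uT, uA, eH]) (by simp [uB, uT, uA, eH]) (by simp [uB, uT, uA, eH]) (by simp [uB, uT, uA, eH]) (by simp [uB, uT, uA, eH]) (by simp [uB, uT, uA, eH]) (by simp [uB, uT, uA, eH]) (by simp [uB, uT, uA, eH]) (by simp [uB, uT, uA, eH]) (by simp [uB, uT, uA, eH]) (by simp [uB, uT, uA, eH]) (by simp [uB, uT, uA, eH]) (by simp [uB, uT, uA, eH]) (by simp [uB, uT, uA, eH]) (by simp [uB, uT, uA, eH]) (by simp [uB, uT, uA, eH]) (by simp [uB, uT, uA, eH]) (by simp [uB, uT, uA, eH]) (by simp [uB, uT, uA, eH]) (by simp [uB, uT, uA, eH]) (by simp [uB, uT, uA, eH]) (by simp [uB, uT, uA, eH]) (by simp [uB, uT, uA, eH]) (by simp [uB, uT, uA, eH]) (by simp [uB, uT, uA, eH]) (by simp [uB, uT, uA, eH]) (by simp [uB, uT, uA, eH]) (by simp [uB, uT, uA, eH]) (by simp [uB]) (by simp [uB, uT, uA, eH]) (by simp [uB, uT, uA, eH]) (by simp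 [uB, uT, uA, eH]) (by simp [uB, uT, uA, eH]) (by simp [uB, uT, uA, eH]) (by simp [uB, uT, uA, eH]) (by simp [uB, uT, uA, eH]) (by simp [uB, uT]) (by simp [uB, uT, uA, eH]) (by simp [uB, uT, uA, eH]) (by simp [uB, uT, uA, eH]) (by simp [uB, uT, uA, eH]) (by simp [uB, uT, uA, eH]) (by simp [uB, uT, uA, eH]) (by simp [uB, uT, uA, eH]) (by simp [uB, uT, uA, eH]) (by simp [uB, uT, uA, eH]) (by simp [uB, uT, uA, eH]) (by simp [uB, uT, uA, eH]) (by simp [uB, uT, uA, eH]) (by simp [uB, uT, uA, eH]) (by simp [uB, uT, uA, eH]) (by simp [uB, uT, uA, eH]) (by simp [uB, uT, uA, eH]) (by simp [uB, uT, uA, eH]) (by simp [uB, uT, uA, eH]) (by simp [uB, uT, uA, eH]) (by simp [uB, uT, uA, eH]) (by simp [uB, uT, uA, eH]) (by simp [uB, uT, uA, eH]) (by simp [uB, uT, uA, eH]) (by simp [uB, uT, uA, eH]) (by simp [uB, uT, uA, eH]) (by simp [uB, uT, uA, eH]) (by simp [uB, uT, uA, eH]) (by simp [uB, uT, uA, eH])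 (by simp [uB, uT, uA, eH]) (by simp [uB, uT, uA, eH]) (by simp [uB, uT, uA, eH]) (by simp [uB, uT, uA, eH]) (by simp [uB, uT, uA, eH]) (by simp [uB, uT, uA, eH]) (by simp [uB, uT, uA, eH]) (by simp [uB, uT, uA, eH]) (by simp [uB, uT, uA, eH]) (by simp [uB, uT, uA, eH]) (by simp [uB, uT, uA, eH]) (by simp [uB, uT, uA, eH])
  have hst4 : uB.rdAt 7 (stack0 (tdOf N).1, []) = { uT with x2 := [], mnc := [], mn0 := [], mnb := encodeNat B, blpow := encodeNat 2, mni := encVec (stack0 (tdOf N).1), inp := List.replicate 7 true } := by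
    simp [HSlots.rdAt, uB, uT, uA, eH, encVec]
  rw [hst4] at h4
  have hro : roundsRun B (stack0 (tdOf N).1, []) 7 = roundsOf N := by rw [roundsOf, hB0]
  rw [hro] at h4
  -- the output
  let uR : HSlots := uB.rdAt 0 (roundsOf N)
  have h5 := runs_output h (N := N) hn T hI uR (roundsOf N).1 (roundsOf N).2 (tdOf N).2 hps B hlB (by simp [uR, uB, HSlots.rdAt]) (by simp [uR, uB, HSlots.rdAt]) (by simp [uR, uB, HSlots.rdAt])
    (by simp [uR, uB, uT, HSlots.rdAt]) (by simp [uR, uB, uT, uA, HSlots.rdAt, ← hnN0]) (by simp [uR, uB, HSlots.rdAt]) (by simp [uR, uB, HSlots.rdAt]) (by simp [uR, uB, uT, uA, HSlots.rdAt, eH])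
    (by simp [uR, uB, uT, uA, HSlots.rdAt, eH]) (by simp [uR, uB, uT, uA, HSlots.rdAt, eH]) (by simp [uR, uB, uT, uA, HSlots.rdAt, eH]) (by simp [uR, uB, uT, uA, HSlots.rdAt, eH]) (by simp [uR, uB, uT, uA, HSlots.rdAt, eH]) (by simp [uR, uB, uT, uA, HSlots.rdAt, eH]) (by simp [uR, uB, uT, uA, HSlots.rdAt, eH]) (by simp [uR, uB, uT, uA, HSlots.rdAt, eH]) (by simp [uR, uB, uT, uA, HSlots.rdAt, eH]) (by simp [uR, uB, uT, uA, HSlots.rdAt, eH]) (by simp [uR, uB, uT, uA, HSlots.rdAt, eH]) (by simp [uR, uB, uT, uA, HSlots.rdAt, eH]) (by simp [uR, uB, uT, uA, HSlots.rdAt, eH]) (by simp [uR, uB, uT, uA, HSlots.rdAt, eH]) (by simp [uR, uB, uT, uA, HSlots.rdAt, eH]) (by simp [uR, uB, uT, uA, HSlots.rdAt, eH]) (by simp [uR, uB, uT, uA, HSlots.rdAt, eH]) (by simp [uR, uB, uT, uA, HSlots.rdAt, eH]) (by simp [uR, uB, uT, uA, HSlots.rdAt, eH]) (by simp [uR, uB,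 uT, uA, HSlots.rdAt, eH]) (by simp [uR, uB, uT, uA, HSlots.rdAt, eH]) (by simp [uR, uB, uT, uA, HSlots.rdAt, eH]) (by simp [uR, uB, uT, uA, HSlots.rdAt, eH]) (by simp [uR, uB, uT, uA, HSlots.rdAt, eH])
  rw [← hnN0] at h5
  refine (h1.seq (h2.seq (h3.seq (h4.seq h5)))).of_eq ?_ ?_
  · simp [uR, uB, uT, uA, HSlots.rdAt, eH, factorOut, ← hnN0]
  · simp only [mainCost, ← hnN0, ← hn0, ← hTn0, ← hB0]; exact le_rfl

end MainAssembly

end Com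

end Literature.Computability.Complexity
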